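import Literature.MathematicalPhysics.QuantumFieldTheory.Balaban1983to89.B6Prop25HolderTwoScaleV1
import Literature.MathematicalPhysics.QuantumFieldTheory.Balaban1983to89.B6HjOneLevelBridgeV1

/-!
# `Balaban1983to89.B6Prop25HolderRateFreeV1` — T. Bałaban, *Propagators and renormalization transformations for lattice gauge theories. II*,
# Commun. Math. Phys. **96** (1984) 223–250 [Balaban1984PropagatorsII], PROPOSITION 2.5 p. 246: THE HÖLDER MEMBER `‖ζ∇GJ‖_α` OF (1.111) FOR THE
# GENUINE TWO-SCALE `G = Δ_a⁻¹` OF (2.90), `Λ′ ⊂ T^{(j+1)}` ARBITRARY, WITH THE DECAY RATE INDEPENDENT OF `α` AS PRINTED («δ₂ … depends on d and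
# L only») — the `_rateFree` twins of p38's `B6BlockHolderCompositesV1` §3–§4 and `B6Prop25HolderTwoScaleV1` §1–§2, fed with r03's
# `B6HjOneLevelBridgeV1.holderBound_DHj_rateFree`

statement-level skeleton of published theorems with citation tags; proofs where landed; nothing here is a claim about the Yang–Mills mass gap

PDF held: `paper:balaban1984-cmp96-propagators-rt-ii` (journal page = PDF page + 222; p. 246 = PDF 24, text layer `p0024.txt` L13–L19, read this
seat 2026-08-22); `paper:balaban1984-cmp95-propagators-rt-i` ([4]; journal page = PDF page + 16; p. 35 = PDF 19).

PRINT (verbatim).  [B6] p. 246 (Proposition 2.5): *"The operator G defined by (2.90) … has the representation (2.129) and satisfies all the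
inequalities (1.110)–(1.114) of the Proposition 1.2 with a positive constant δ₂ instead of δ₀. This constant depends on d and L only."*; p. 246:
*"we get the formula H_j = G_jQ_j*(Q_jG_jQ_j*)⁻¹. (2.130) Thus this operator coincides with the operator introduced in Sect. D. … They follow from
the Proposition 1.2 and from the formulas and the inequalities (1.99)–(1.101) for Q_jG_jQ_j*."*  [4] (1.111) p. 35: *"‖ζ∇GJ‖_α, ‖ζG∇*J‖_α ≤
O(1)e^{−δ₀|y−y′|}(‖ζ‖_α + |ζ|)|J| for 0 ≤ α < 1, ζ ∈ C^∞(Δ̃(y)), supp J ⊂ Δ̃(y′), with the constant O(1) depending on d and α (O(1) → ∞ if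
α → 1)"*; (1.109): *"‖∇A‖_α = sup_{μ,ν, x,x′: |x−x′| ≤ 1} |x − x′|^{−α}|(∂_μA_ν)(x) − (∂_μA_ν)(x′)|"*.

CITATION HEADER (lean-in-tree rule) — WHAT IS REPRODUCED.  Phase-2 file of the `lit-balaban` typed skeleton (HOME `run/shared/lean/pub/lit-balaban/`),
seat **r03 gen 16** (B6 fold owner, own lane; referee ref-4), executing HOME/GAPS.md **G-B6-p38-01, UPGRADE PATH (a)**, second half: the MEMBER
re-thread.  The first half — the kernel bridge (2.130) ↔ [4] (1.103) and the `α`-free factor bound `holderBound_DHj_rateFree` — is r03's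
`B6HjOneLevelBridgeV1` (p333936); p38 (gen 22, 2026-08-22T16:08Z) asked for `_rateFree` TWINS of its composites rather than a re-thread of its own
files, which is what this file is.  SKELETON row **B6.Prop2.5** (member cells only; every decl of record untouched: p22's `…B6SectCOperators.TwoScaleData`
/ `…B6SectCTwoScaleV1Lattice.tsV1` p255063 ff., p38's `…B6BlockHolderCompositesV1.holderBound_DHjCtHj_scaling` / `holderBound_DGt_scaling` and
`…B6Prop25HolderTwoScaleV1.holderBound_DG_scaling` / `prop25_ineq111_grad`, which stay as they are, at their rate `δ₂(1−α)`).  Inputs BY NAME,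
restating nothing: r03's `…B6HjOneLevelBridgeV1.holderBound_DHj_rateFree`; p38's pair calculus `…B6BlockHolderCalculus.holderBound_comp` /
`holderBound_add` / `holderBound_sub` / `holderBound_mono` / `pairDiff_le_of_support` / `abs_cutoff_pairDiff_le`, p38's first-factor pair bounds
`…B6BlockHolderCompositesV1.holderBound_DK1_scaling` / `holderBound_DK2adj_scaling`, `…B6BlockHolderGEV1.holderBound_DGE_scaling`; p22's block
bounds `…B6BlockDecayGradFactorsV1.blockBound_Ct_scaling`, `…B6BlockDecayHjCovV1.blockBound_Hj_adjoint` / `blockBound_HjCtHj_scaling`,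
`…B6BlockDecayGtV1.blockBound_GE_scaling` / `blockBound_Qv` / `Gt_eq_comp_GE` / `blockBound_Gt_scaling`, `…B6BlockDecayK12V1.blockBound_K2_scaling`,
`…B6Prop25GradDecayTwoScaleV1.blockBound_DG_scaling`, the operator identity `…B6Repr2129Operator.G_eq_op_V1` ((2.129)) and the block calculus
`…B6BlockDecayCalculus`.

WHAT IS PROVED (kernel-checked; THEOREMS ONLY — no `def`, no `def … : Prop`, nothing is a named unproved fact; standard axioms).  For the concrete
two-scale data `tsV1 hc Λ′ w` at the scaling `c = L^j` (`n = L^j`, `j + 1 ≤ m + K`, `Λ′ ⊂ T^{(j+1)}` ARBITRARY), `D_λ = n(S_λ − I)`, `t = |x − x′|_∞/n ≤ 1`: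
* §1 **`holderBound_DHjCtHj_rateFree`** (weights `a₀n^{d+1} ≤ w ≤ a₁n^{d+1}`): `∃ δ(d, L, a₀, a₁) > 0 ∀ 0 ≤ α < 1 ∃ C_α ≥ 0`: the pair kernel of
  `(D_λH_j)C̃^{(j)}_ΛH_j*` is bounded by `(C_α·t^α, δ)`.
* §2 **`holderBound_DGt_rateFree`** (weights `w > 0`): the same for `D_λG̃_j`, `δ(d, L)`.
* §3 **`holderBound_DG_rateFree`**: the same for `D_λG`, `G = Δ_a⁻¹` of (2.90) through (2.129): `Σ_{b₀′ : y(b₀′₋) = y}|(D_λG)(e_{b₀′})_{b₁} −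
  (D_λG)(e_{b₀′})_{b₂}| ≤ C_α·t^α·e^{−δ₂|y(x) − y|_T}`, `δ₂ = δ₂(d, L, a₀, a₁)`.
* §4 **`prop25_ineq111_grad_rateFree`**: THE PRINTED SHAPE of the member `‖ζ∇GJ‖_α` of (1.111): for a cut-off `ζ` on the fine sites supported over
  the unit sites within `r` of `y`, `|ζ| ≤ Z₀`, `|ζ(x) − ζ(x′)| ≤ Z_h·t^α`, and `J` supported over the unit sites within `r` of `y′`, `|J| ≤ X`:
  `|ζ(x)(∇_λGJ)_ν(x) − ζ(x′)(∇_λGJ)_ν(x′)| ≤ C_α·e^{(1+2δ₂)(r+1)}·e^{−δ₂|y − y′|_T}·(Z_h + Z₀)·|J|·t^α` with ONE `δ₂ > 0` FOR ALL `0 ≤ α < 1`.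
The four proofs are p38's, line for line (credit: `lit-balaban-p38` gen 21–22), with exactly one change of input — `holderBound_DHj_rateFree`
(rate `δ_H(d, L)`) for `holderBound_DHj` (rate `κ_H(1−α)/(1+α)`) — and the rate bookkeeping simplified accordingly (`δ = min(δ₁, δ_H/2)` in §1,
`min(min(δ₁, δ_D), δ_H/2)` in §2, the work rates `δ₀, δ₀/2, δ₀/4` in §3, `min(δ_S, δ_H)` in §4 — no factor `(1−α)` anywhere).

HONEST SCOPE / DIVERGENCES. (1) This reaches the PRINTED quantifier shape of the (1.111)₁ member for the genuine two-scale `G_□`: one `δ₂` (of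
`d, L` and the weight window `a₀, a₁` — the window is the tree's packaging of the printed `a(L^kη)^{-2} = a n^{d+1}`-type weights, p22) before
`∀ α < 1`, `C_α` after; the constants are ours (p09/p19's unevaluated `rate722`/`holderConst` inside `δ_H`, `C_H(α)`), the print's `O(1)` is quoted as
a target only. (2) Only pairs `x, x′` with `|x − x′|_∞ ≤ n` (= (1.109)'s `|x − x′| ≤ 1`) and bonds of equal direction `ν`; `∇_λ` = forward difference
times `η⁻¹ = L^j`; `ζ ∈ C^∞(Δ̃(y))`, `supp J ⊂ Δ̃(y′)` are replaced by supports over the unit sites within `r` of `y`, `y′` (radius-`r` packaging as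
in p22's (1.110) files and p38's file 5, growth `e^{(1+2δ₂)(r+1)}`). (3) The member `‖ζG∇*J‖_α` ((1.111)₂, `α`-free already: p38's
`prop25_ineq111_div`, r03's census v1.3 `ineq111_ten_TS`) and (1.112)–(1.114) are not treated here; the census clause `ineq111_vec_TS` /
the second conjunct of `B5.Ineq110_114` on `settingTS` for ALL `α < 1` is the next census version (r03), not this file. (4) No new definition, no
new hypothesis, no restatement: every operator is a landed decl BY NAME; p38's `δ₂(1−α)` theorems are neither edited nor deprecated.  Value: closes
HOME/GAPS.md G-B6-p38-01 at the member level (the `α`-free rate of (1.111)₁ for `G_□`); NOT summit progress.  Unit `lit-balaban-r03` (gen 16,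
literature-prover-lit-balaban-r03-g16-0), 2026-08-22.
-/

noncomputable section

open scoped InnerProductSpace BigOperators
open Finset

namespace Literature.MathematicalPhysics.QuantumFieldTheory.Balaban1983to89.B6Prop25HolderRateFreeV1

open LatticeFieldCalculus B5SectBStatements B5Eq117TorusCarriers B6SectADomainsV1 B6SectAOperatorsV1 B6SectAVectorModelV1 B6SectCOperators
  B6SectCTwoScaleV1 B6SectCTwoScaleV1Lattice B5Eq118OneStroke

open BalabanImbrieJaffe1984to88.BIJ85AxialPropagator411 (BondSpace)
open B4Sect5Torus (IsPseudoDist SumBound)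
open B4TorusKernel (periodConst)
open B4TorusKernel.MultiPeriod (torusSupNorm torusSupNorm_nonneg)
open B4Sect5Proof (latticeConst latticeConst_nonneg)
open B5Hk163Decay (MG163 MG163_nonneg)
open B5Hk163Strip (kappa163 kappa163_pos)
open B5Kernel166Decay (periodConst_pos)
open B6LowerBound2153Torus (rep)
open B6Repr2129Operator (G_eq_op_V1)
open B6BlockDecayCalculus (blockBound_comp blockBound_add blockBound_sub blockBound_id blockBound_mono abs_apply_le_of_support
  torusDist_isPseudoDist torusDist_sumBound)
open B6BlockDecayHjCovV1 (blockBound_Hj_adjoint blockBound_HjCtHj_scaling)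
open B6BlockDecayHprimeCovV1 (supDist_cast_eq_torusSupNorm)
open B6BlockDecayK12V1 (blockBound_K2_scaling)
open B6BlockDecayGtV1 (Gt_eq_comp_GE blockBound_GE_scaling blockBound_Qv blockBound_Gt_scaling)
open B6BlockDecayGradFactorsV1 (blockBound_Ct_scaling Dop_comp_apply)
open B6Prop25GradDecayTwoScaleV1 (blockBound_DG_scaling)
open B6BlockHolderCalculus (holderBound_comp holderBound_add holderBound_sub holderBound_mono pairDiff_le_of_support abs_cutoff_pairDiff_le
  self_le_rpow_of_le_one')
open B6BlockHolderGEV1 (holderBound_DGE_scaling)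
open B6BlockHolderCompositesV1 (holderBound_DK1_scaling holderBound_DK2adj_scaling)
open B6HjOneLevelBridgeV1 (holderBound_DHj_rateFree)
open BalabanImbrieJaffe1984to88.BIJ85Ineq722Torus (supDist_blk_le_one)

/-! ## §1  `D_λ(H_jC̃^{(j)}_ΛH_j*)` at an `α`-free rate -/

open Classical in
/-- **`D_λ(H_jC̃^{(j)}_ΛH_j*) = (D_λH_j)C̃^{(j)}_ΛH_j*` HAS AN EXPONENTIALLY DECAYING PAIR KERNEL WITH A RATE INDEPENDENT OF `α`** (at `c = L^j`,
weights `a₀n^{d+1} ≤ w ≤ a₁n^{d+1}`): there is `δ > 0` (depending on `d, L, a₀, a₁`, NOT on `α`) and for every `0 ≤ α < 1` a `C_α ≥ 0` with the pair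
bound `(C_α·t^α, δ)`, `t = |x − x′|_∞/n ≤ 1` — the `_rateFree` twin of p38's `…B6BlockHolderCompositesV1.holderBound_DHjCtHj_scaling` (same proof,
same tail `C̃^{(j)}_ΛH_j*` from p22's `blockBound_Ct_scaling`, `blockBound_Hj_adjoint`), the first factor `D_λH_j` now by r03's
`…B6HjOneLevelBridgeV1.holderBound_DHj_rateFree` ((2.130) = [4] (1.103) + [BalabanImbrieJaffe1985] (7.2.2), rate `δ_H(d, L)`).
[cite: Balaban1984PropagatorsII, Prop. 2.5 p.246, (2.130) p.246; Balaban1984PropagatorsI, (1.111) p.35] -/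
theorem holderBound_DHjCtHj_rateFree (d L : ℕ) (hd : 1 ≤ d + 1) (hL : Odd L ∧ 1 < L) {a₀ a₁ : ℝ} (ha₀ : 0 < a₀) (ha₁ : a₀ ≤ a₁) :
    ∃ δ : ℝ, 0 < δ ∧ ∀ α : ℝ, 0 ≤ α → α < 1 → ∃ C : ℝ, 0 ≤ C ∧ ∀ (m K : ℕ) (j : ℕ) (hc : ((L : ℝ) ^ j) ≠ 0)
      (_hj : j + 1 ≤ (⟨d + 1, L, m, K, hd, hL⟩ : Params).m + (⟨d + 1, L, m, K, hd, hL⟩ : Params).K)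
      (Λ' : Finset (Site (⟨d + 1, L, m, K, hd, hL⟩ : Params) (j + 1))) (w : CIdx j Λ' → ℝ)
      (_hw0 : ∀ i, a₀ * ((L : ℝ) ^ j) ^ (d + 1) ≤ w i) (_hw1 : ∀ i, w i ≤ a₁ * ((L : ℝ) ^ j) ^ (d + 1)) (lam : Fin (d + 1))
      (b₁ b₂ : PBond (⟨d + 1, L, m, K, hd, hL⟩ : Params) 0) (_hdir : b₁.dir = b₂.dir) (_hle : supDist b₁.src b₂.src ≤ L ^ j) (y : Site (⟨d + 1, L, m, K, hd, hL⟩ : Params) j),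
      ∑ b₀' ∈ univ.filter (fun b₀' : PBond (⟨d + 1, L, m, K, hd, hL⟩ : Params) 0 => iterBlockOf j b₀'.src = y),
          |(((((L : ℝ) ^ j) • (onE (LinearMap.funLeft ℝ ℝ (fun b : PBond (⟨d + 1, L, m, K, hd, hL⟩ : Params) 0 =>
              (⟨b.src.shift lam, b.dir⟩ : PBond (⟨d + 1, L, m, K, hd, hL⟩ : Params) 0))) - LinearMap.id) :
          BondSpace (⟨d + 1, L, m, K, hd, hL⟩ : Params) →ₗ[ℝ] BondSpace (⟨d + 1, L, m, K, hd, hL⟩ : Params))) ∘ₗ ((tsV1 hc Λ' w).Hj ∘ₗ (tsV1 hc Λ' w).Ct ∘ₗ LinearMap.adjoint (tsV1 hc Λ' w).Hj)) (EuclideanSpace.single b₀' (1 : ℝ)) b₁ -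
           (((((L : ℝ) ^ j) • (onE (LinearMap.funLeft ℝ ℝ (fun b : PBond (⟨d + 1, L, m, K, hd, hL⟩ : Params) 0 =>
              (⟨b.src.shift lam, b.dir⟩ : PBond (⟨d + 1, L, m, K, hd, hL⟩ : Params) 0))) - LinearMap.id) :
          BondSpace (⟨d + 1, L, m, K, hd, hL⟩ : Params) →ₗ[ℝ] BondSpace (⟨d + 1, L, m, K, hd, hL⟩ : Params))) ∘ₗ ((tsV1 hc Λ' w).Hj ∘ₗ (tsV1 hc Λ' w).Ct ∘ₗ LinearMap.adjoint (tsV1 hc Λ' w).Hj)) (EuclideanSpace.single b₀' (1 : ℝ)) b₂| ≤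
        C * (((supDist b₁.src b₂.src : ℕ) : ℝ) / (L : ℝ) ^ j) ^ α * Real.exp (-(δ * torusSupNorm (Mk (⟨d + 1, L, m, K, hd, hL⟩ : Params) j)
            (rep (Mk (⟨d + 1, L, m, K, hd, hL⟩ : Params) j) (iterBlockOf j b₁.src) - rep (Mk (⟨d + 1, L, m, K, hd, hL⟩ : Params) j) y))) := by
  obtain ⟨δC, hδC, E, hE, hCt⟩ := blockBound_Ct_scaling d L hd hL ha₀ ha₁
  obtain ⟨δH, hδH, HH⟩ := holderBound_DHj_rateFree d L hd hL
  set κH : ℝ := kappa163 (d + 1) / ((d : ℝ) + 1) with hκH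
  have hκH0 : 0 < κH := div_pos (kappa163_pos _) (by positivity)
  -- rates: the tail at `δ₁ = min(δ_C/2, κ_H)`; the product at `δ = min(δ₁, δ_H/2)` (`δ ≤ δ₁`, `δ < δ_H`) — independent of `α`
  set δ₁ : ℝ := min (δC / 2) κH with hδ₁
  have hδ₁0 : 0 < δ₁ := lt_min (half_pos hδC) hκH0
  have hδ₁C : δ₁ < δC := lt_of_le_of_lt (min_le_left _ _) (half_lt_self hδC)
  have hδ₁H : δ₁ ≤ κH := min_le_right _ _
  set δ : ℝ := min δ₁ (δH / 2) with hδ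
  have hδ0 : 0 < δ := lt_min hδ₁0 (half_pos hδH)
  have hδδ₁ : δ ≤ δ₁ := min_le_left _ _
  have hδH' : δ < δH := lt_of_le_of_lt (min_le_right _ _) (half_lt_self hδH)
  set K₁ : ℝ := latticeConst (d + 1) (δC - δ₁) with hK₁
  have hK₁0 : 0 ≤ K₁ := latticeConst_nonneg _ (by linarith)
  set K₂ : ℝ := latticeConst (d + 1) (δH - δ) with hK₂
  have hK₂0 : 0 ≤ K₂ := latticeConst_nonneg _ (by linarith)
  have hL0 : 0 < L := by have := hL.2; omega
  haveI : NeZero L := ⟨by omega⟩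
  have hLp : (0 : ℝ) < L := by exact_mod_cast hL0
  set AH : ℝ := MG163 (d + 1) * periodConst (kappa163 (d + 1)) d with hAH
  have hAH0 : 0 ≤ AH := mul_nonneg (MG163_nonneg _) (periodConst_pos (kappa163_pos _) _).le
  refine ⟨δ, hδ0, fun α hα0 hα1 => ?_⟩
  obtain ⟨CH, hCH, hH⟩ := HH α hα0 hα1
  set C : ℝ := CH * (E * (AH * ((d + 1 : ℕ) : ℝ)) * K₁) * K₂ with hC
  have hC0 : 0 ≤ C := by positivity
  refine ⟨C, hC0, ?_⟩
  intro m K j hc hj Λ' w hw0 hw1 lam b₁ b₂ hdir hle y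
  have hj' : j ≤ m + K := Nat.le_of_succ_le hj
  set n : ℝ := ((L : ℝ) ^ j) ^ (d + 1) with hn
  have hn0 : 0 < n := by positivity
  have hLj : (0 : ℝ) < (L : ℝ) ^ j := by positivity
  have hw : ∀ i, 0 < w i := fun i => lt_of_lt_of_le (by positivity) (hw0 i)
  have ht0 : 0 ≤ (((supDist b₁.src b₂.src : ℕ) : ℝ) / (L : ℝ) ^ j) ^ α := Real.rpow_nonneg (by positivity) _
  have hρ : IsPseudoDist (fun t t' : Site (⟨d + 1, L, m, K, hd, hL⟩ : Params) j => torusSupNorm (Mk (⟨d + 1, L, m, K, hd, hL⟩ : Params) j) (rep (Mk (⟨d + 1, L, m, K, hd, hL⟩ : Params) j) t - rep (Mk (⟨d + 1, L, m, K, hd, hL⟩ : Params) j) t')) := torusDist_isPseudoDist (Mk (⟨d + 1, L, m, K, hd, hL⟩ : Params) j)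
  have hK : SumBound (fun t t' : Site (⟨d + 1, L, m, K, hd, hL⟩ : Params) j => torusSupNorm (Mk (⟨d + 1, L, m, K, hd, hL⟩ : Params) j) (rep (Mk (⟨d + 1, L, m, K, hd, hL⟩ : Params) j) t - rep (Mk (⟨d + 1, L, m, K, hd, hL⟩ : Params) j) t')) (fun a => latticeConst (d + 1) a) := torusDist_sumBound (Mk (⟨d + 1, L, m, K, hd, hL⟩ : Params) j)
  have hcast : (((L ^ j) ^ (d + 1) * (d + 1) : ℕ) : ℝ) = n * ((d + 1 : ℕ) : ℝ) := by rw [hn]; push_cast; ring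
  -- the first factor `D_λH_j`: pair bound `(C_H(α)·t^α, δ_H)`, `δ_H` independent of `α` (r03's `holderBound_DHj_rateFree`)
  have hf : ∀ y' : Site (⟨d + 1, L, m, K, hd, hL⟩ : Params) j, ∑ b ∈ univ.filter (fun b : PBond (⟨d + 1, L, m, K, hd, hL⟩ : Params) j => b.src = y'),
      |(((((L : ℝ) ^ j) • (onE (LinearMap.funLeft ℝ ℝ (fun b : PBond (⟨d + 1, L, m, K, hd, hL⟩ : Params) 0 =>
              (⟨b.src.shift lam, b.dir⟩ : PBond (⟨d + 1, L, m, K, hd, hL⟩ : Params) 0))) - LinearMap.id) :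
          BondSpace (⟨d + 1, L, m, K, hd, hL⟩ : Params) →ₗ[ℝ] BondSpace (⟨d + 1, L, m, K, hd, hL⟩ : Params))) ∘ₗ (tsV1 hc Λ' w).Hj) (EuclideanSpace.single b (1 : ℝ)) b₁ -
       (((((L : ℝ) ^ j) • (onE (LinearMap.funLeft ℝ ℝ (fun b : PBond (⟨d + 1, L, m, K, hd, hL⟩ : Params) 0 =>
              (⟨b.src.shift lam, b.dir⟩ : PBond (⟨d + 1, L, m, K, hd, hL⟩ : Params) 0))) - LinearMap.id) :
          BondSpace (⟨d + 1, L, m, K, hd, hL⟩ : Params) →ₗ[ℝ] BondSpace (⟨d + 1, L, m, K, hd, hL⟩ : Params))) ∘ₗ (tsV1 hc Λ' w).Hj) (EuclideanSpace.single b (1 : ℝ)) b₂| ≤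
      CH * (((supDist b₁.src b₂.src : ℕ) : ℝ) / (L : ℝ) ^ j) ^ α *
        Real.exp (-(δH *
          torusSupNorm (Mk (⟨d + 1, L, m, K, hd, hL⟩ : Params) j) (rep (Mk (⟨d + 1, L, m, K, hd, hL⟩ : Params) j) (iterBlockOf j b₁.src) - rep (Mk (⟨d + 1, L, m, K, hd, hL⟩ : Params) j) y'))) :=
    fun y' => hH m K j hc hj Λ' w hw lam b₁ b₂ hdir hle y'
  -- the tail factors: `H_j*` `(A_H n^{d+1}(d+1), κ_H)` (p22 file 3), `C̃^{(j)}_Λ` `(E/n^{d+1}, δ_C)` (p22 file 8)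
  have hTs : ∀ (b : PBond (⟨d + 1, L, m, K, hd, hL⟩ : Params) j) (y : Site (⟨d + 1, L, m, K, hd, hL⟩ : Params) j),
      ∑ b₀ ∈ univ.filter (fun b₀ : PBond (⟨d + 1, L, m, K, hd, hL⟩ : Params) 0 => iterBlockOf j b₀.src = y),
          |LinearMap.adjoint (tsV1 hc Λ' w).Hj (EuclideanSpace.single b₀ (1 : ℝ)) b| ≤
        AH * (n * ((d + 1 : ℕ) : ℝ)) * Real.exp (-(κH * torusSupNorm (Mk (⟨d + 1, L, m, K, hd, hL⟩ : Params) j) (rep (Mk (⟨d + 1, L, m, K, hd, hL⟩ : Params) j) b.src - rep (Mk (⟨d + 1, L, m, K, hd, hL⟩ : Params) j) y))) := by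
    intro b y
    refine (blockBound_Hj_adjoint hc hj Λ' hw b y).trans (le_of_eq ?_)
    rw [hcast]
  have hCb : ∀ (b : PBond (⟨d + 1, L, m, K, hd, hL⟩ : Params) j) (y : Site (⟨d + 1, L, m, K, hd, hL⟩ : Params) j),
      ∑ b' ∈ univ.filter (fun b' : PBond (⟨d + 1, L, m, K, hd, hL⟩ : Params) j => b'.src = y), |(tsV1 hc Λ' w).Ct (EuclideanSpace.single b' (1 : ℝ)) b| ≤
        E / n * Real.exp (-(δC * torusSupNorm (Mk (⟨d + 1, L, m, K, hd, hL⟩ : Params) j) (rep (Mk (⟨d + 1, L, m, K, hd, hL⟩ : Params) j) b.src - rep (Mk (⟨d + 1, L, m, K, hd, hL⟩ : Params) j) y))) :=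
    fun b y => hCt m K j hc hj Λ' w hw0 hw1 b y
  -- the tail `C̃^{(j)}_ΛH_j*`: block bound `(E/n^{d+1}·A_H n^{d+1}(d+1)·K₁, δ₁)`
  have hg : ∀ (b : PBond (⟨d + 1, L, m, K, hd, hL⟩ : Params) j) (y : Site (⟨d + 1, L, m, K, hd, hL⟩ : Params) j), ∑ b₀ ∈ univ.filter (fun b₀ : PBond (⟨d + 1, L, m, K, hd, hL⟩ : Params) 0 => iterBlockOf j b₀.src = y),
      |((tsV1 hc Λ' w).Ct ∘ₗ LinearMap.adjoint (tsV1 hc Λ' w).Hj) (EuclideanSpace.single b₀ (1 : ℝ)) b| ≤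
      E / n * (AH * (n * ((d + 1 : ℕ) : ℝ))) * K₁ *
        Real.exp (-(δ₁ * torusSupNorm (Mk (⟨d + 1, L, m, K, hd, hL⟩ : Params) j) (rep (Mk (⟨d + 1, L, m, K, hd, hL⟩ : Params) j) b.src - rep (Mk (⟨d + 1, L, m, K, hd, hL⟩ : Params) j) y))) := by
    intro b y
    have h := blockBound_comp hρ hK (tsV1 hc Λ' w).Ct (LinearMap.adjoint (tsV1 hc Λ' w).Hj)
      (fun b : PBond (⟨d + 1, L, m, K, hd, hL⟩ : Params) j => b.src) (fun b : PBond (⟨d + 1, L, m, K, hd, hL⟩ : Params) j => b.src) (fun b₀ : PBond (⟨d + 1, L, m, K, hd, hL⟩ : Params) 0 => iterBlockOf j b₀.src)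
      (by positivity : 0 ≤ E / n) (by positivity : 0 ≤ AH * (n * ((d + 1 : ℕ) : ℝ))) hδ₁0.le hδ₁H hδ₁C hCb hTs b y
    rw [hK₁]; exact h
  rw [← LinearMap.comp_assoc]
  have h := holderBound_comp hρ hK (((((L : ℝ) ^ j) • (onE (LinearMap.funLeft ℝ ℝ (fun b : PBond (⟨d + 1, L, m, K, hd, hL⟩ : Params) 0 =>
              (⟨b.src.shift lam, b.dir⟩ : PBond (⟨d + 1, L, m, K, hd, hL⟩ : Params) 0))) - LinearMap.id) :
          BondSpace (⟨d + 1, L, m, K, hd, hL⟩ : Params) →ₗ[ℝ] BondSpace (⟨d + 1, L, m, K, hd, hL⟩ : Params))) ∘ₗ (tsV1 hc Λ' w).Hj) ((tsV1 hc Λ' w).Ct ∘ₗ LinearMap.adjoint (tsV1 hc Λ' w).Hj)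
    (fun b : PBond (⟨d + 1, L, m, K, hd, hL⟩ : Params) j => b.src) (fun b₀ : PBond (⟨d + 1, L, m, K, hd, hL⟩ : Params) 0 => iterBlockOf j b₀.src) b₁ b₂ (iterBlockOf j b₁.src)
    (by positivity : 0 ≤ CH * (((supDist b₁.src b₂.src : ℕ) : ℝ) / (L : ℝ) ^ j) ^ α)
    (by positivity : 0 ≤ E / n * (AH * (n * ((d + 1 : ℕ) : ℝ))) * K₁)
    hδ0.le hδδ₁ hδH' hf hg y
  refine h.trans (le_of_eq ?_)
  have hn' : E / n * (AH * (n * ((d + 1 : ℕ) : ℝ))) = E * (AH * ((d + 1 : ℕ) : ℝ)) := by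
    field_simp
  rw [hn', hC, hK₁, hK₂]
  ring

/-! ## §2  `D_λG̃_j` at an `α`-free rate -/

open Classical in
/-- **`D_λG̃_j` HAS AN EXPONENTIALLY DECAYING PAIR KERNEL WITH A RATE INDEPENDENT OF `α`** (at `c = L^j`): there is `δ > 0` depending on `d, L`
only and for every `0 ≤ α < 1` a `C_α ≥ 0` with the pair bound `(C_α·t^α, δ)` — the `_rateFree` twin of p38's
`…B6BlockHolderCompositesV1.holderBound_DGt_scaling`: `D_λG̃_j = D_λG^{(n^{d+1})} − (D_λH_j)(Q_jG^{(n^{d+1})})` (p22's `Gt_eq_comp_GE`),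
`D_λG^{(n^{d+1})}` by p38's `holderBound_DGE_scaling` ([4] (1.111), rate `δ_D` free of `α`), `D_λH_j` by r03's `holderBound_DHj_rateFree`,
`Q_jG^{(n^{d+1})}` by p22's block bounds. [cite: Balaban1984PropagatorsII, (2.131) p.246, Prop. 2.5 p.246; Balaban1984PropagatorsI, (1.111) p.35] -/
theorem holderBound_DGt_rateFree (d L : ℕ) (hd : 1 ≤ d + 1) (hL : Odd L ∧ 1 < L) :
    ∃ δ : ℝ, 0 < δ ∧ ∀ α : ℝ, 0 ≤ α → α < 1 → ∃ C : ℝ, 0 ≤ C ∧ ∀ (m K : ℕ) (j : ℕ) (hc : ((L : ℝ) ^ j) ≠ 0)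
      (_hj : j + 1 ≤ (⟨d + 1, L, m, K, hd, hL⟩ : Params).m + (⟨d + 1, L, m, K, hd, hL⟩ : Params).K)
      (Λ' : Finset (Site (⟨d + 1, L, m, K, hd, hL⟩ : Params) (j + 1))) (w : CIdx j Λ' → ℝ) (_hw : ∀ i, 0 < w i) (lam : Fin (d + 1))
      (b₁ b₂ : PBond (⟨d + 1, L, m, K, hd, hL⟩ : Params) 0) (_hdir : b₁.dir = b₂.dir) (_hle : supDist b₁.src b₂.src ≤ L ^ j) (y : Site (⟨d + 1, L, m, K, hd, hL⟩ : Params) j),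
      ∑ b₀' ∈ univ.filter (fun b₀' : PBond (⟨d + 1, L, m, K, hd, hL⟩ : Params) 0 => iterBlockOf j b₀'.src = y),
          |(((((L : ℝ) ^ j) • (onE (LinearMap.funLeft ℝ ℝ (fun b : PBond (⟨d + 1, L, m, K, hd, hL⟩ : Params) 0 =>
              (⟨b.src.shift lam, b.dir⟩ : PBond (⟨d + 1, L, m, K, hd, hL⟩ : Params) 0))) - LinearMap.id) :
          BondSpace (⟨d + 1, L, m, K, hd, hL⟩ : Params) →ₗ[ℝ] BondSpace (⟨d + 1, L, m, K, hd, hL⟩ : Params))) ∘ₗ (tsV1 hc Λ' w).Gt) (EuclideanSpace.single b₀' (1 : ℝ)) b₁ -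
           (((((L : ℝ) ^ j) • (onE (LinearMap.funLeft ℝ ℝ (fun b : PBond (⟨d + 1, L, m, K, hd, hL⟩ : Params) 0 =>
              (⟨b.src.shift lam, b.dir⟩ : PBond (⟨d + 1, L, m, K, hd, hL⟩ : Params) 0))) - LinearMap.id) :
          BondSpace (⟨d + 1, L, m, K, hd, hL⟩ : Params) →ₗ[ℝ] BondSpace (⟨d + 1, L, m, K, hd, hL⟩ : Params))) ∘ₗ (tsV1 hc Λ' w).Gt) (EuclideanSpace.single b₀' (1 : ℝ)) b₂| ≤
        C * (((supDist b₁.src b₂.src : ℕ) : ℝ) / (L : ℝ) ^ j) ^ α * Real.exp (-(δ * torusSupNorm (Mk (⟨d + 1, L, m, K, hd, hL⟩ : Params) j)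
            (rep (Mk (⟨d + 1, L, m, K, hd, hL⟩ : Params) j) (iterBlockOf j b₁.src) - rep (Mk (⟨d + 1, L, m, K, hd, hL⟩ : Params) j) y))) := by
  obtain ⟨δG, hδG, CG, hCG, hG⟩ := blockBound_GE_scaling d L hd hL one_pos
  obtain ⟨δD, hδD, HD⟩ := holderBound_DGE_scaling d L hd hL one_pos
  obtain ⟨δH, hδH, HH⟩ := holderBound_DHj_rateFree d L hd hL
  set κH : ℝ := kappa163 (d + 1) / ((d : ℝ) + 1) with hκH
  have hκH0 : 0 < κH := div_pos (kappa163_pos _) (by positivity)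
  -- rates: `Q_jG` at `δ₁ = min(δ_G, κ_H/2)`; everything at `δ = min(min(δ₁, δ_D), δ_H/2)` — independent of `α`
  set δ₁ : ℝ := min δG (κH / 2) with hδ₁
  have hδ₁0 : 0 < δ₁ := lt_min hδG (half_pos hκH0)
  have hδ₁G : δ₁ ≤ δG := min_le_left _ _
  have hδ₁H : δ₁ < κH := lt_of_le_of_lt (min_le_right _ _) (half_lt_self hκH0)
  set δ : ℝ := min (min δ₁ δD) (δH / 2) with hδ
  have hδ0 : 0 < δ := lt_min (lt_min hδ₁0 hδD) (half_pos hδH)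
  have hδδ₁ : δ ≤ δ₁ := (min_le_left _ _).trans (min_le_left _ _)
  have hδD' : δ ≤ δD := (min_le_left _ _).trans (min_le_right _ _)
  have hδH' : δ < δH := lt_of_le_of_lt (min_le_right _ _) (half_lt_self hδH)
  set K₁ : ℝ := latticeConst (d + 1) (κH - δ₁) with hK₁
  have hK₁0 : 0 ≤ K₁ := latticeConst_nonneg _ (by linarith)
  set K₂ : ℝ := latticeConst (d + 1) (δH - δ) with hK₂
  have hK₂0 : 0 ≤ K₂ := latticeConst_nonneg _ (by linarith)
  have hL0 : 0 < L := by have := hL.2; omega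
  haveI : NeZero L := ⟨by omega⟩
  have hLp : (0 : ℝ) < L := by exact_mod_cast hL0
  refine ⟨δ, hδ0, fun α hα0 hα1 => ?_⟩
  obtain ⟨CD, hCD, hDG⟩ := HD α hα0 hα1
  obtain ⟨CH, hCH, hH⟩ := HH α hα0 hα1
  set C : ℝ := CD + CH * (Real.exp κH * CG * K₁) * K₂ with hC
  have hC0 : 0 ≤ C := by positivity
  refine ⟨C, hC0, ?_⟩
  intro m K j hc hj Λ' w hw lam b₁ b₂ hdir hle y
  have hj' : j ≤ m + K := Nat.le_of_succ_le hj
  have hLj : (0 : ℝ) < (L : ℝ) ^ j := by positivity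
  have hw' : (0 : ℝ) < 1 * ((L : ℝ) ^ j) ^ (d + 1) := by positivity
  have ht0 : 0 ≤ (((supDist b₁.src b₂.src : ℕ) : ℝ) / (L : ℝ) ^ j) ^ α := Real.rpow_nonneg (by positivity) _
  have hρ : IsPseudoDist (fun t t' : Site (⟨d + 1, L, m, K, hd, hL⟩ : Params) j => torusSupNorm (Mk (⟨d + 1, L, m, K, hd, hL⟩ : Params) j) (rep (Mk (⟨d + 1, L, m, K, hd, hL⟩ : Params) j) t - rep (Mk (⟨d + 1, L, m, K, hd, hL⟩ : Params) j) t')) := torusDist_isPseudoDist (Mk (⟨d + 1, L, m, K, hd, hL⟩ : Params) j)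
  have hK : SumBound (fun t t' : Site (⟨d + 1, L, m, K, hd, hL⟩ : Params) j => torusSupNorm (Mk (⟨d + 1, L, m, K, hd, hL⟩ : Params) j) (rep (Mk (⟨d + 1, L, m, K, hd, hL⟩ : Params) j) t - rep (Mk (⟨d + 1, L, m, K, hd, hL⟩ : Params) j) t')) (fun a => latticeConst (d + 1) a) := torusDist_sumBound (Mk (⟨d + 1, L, m, K, hd, hL⟩ : Params) j)
  have hGb := hG m K j hj' hc hw'
  have hQ := blockBound_Qv hc hj' Λ' w hκH0.le
  -- `Q_jG` at rate `δ₁` (block bound, p22 files 2, 6)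
  have h1 := blockBound_comp hρ hK (tsV1 hc Λ' w).Qv (GE (Domains.whole (P := (⟨d + 1, L, m, K, hd, hL⟩ : Params)) j hj') hc (w := fun _ => 1 * ((L : ℝ) ^ j) ^ (d + 1)) (fun _ => hw'))
    (fun b : PBond (⟨d + 1, L, m, K, hd, hL⟩ : Params) j => b.src) (fun b₀ : PBond (⟨d + 1, L, m, K, hd, hL⟩ : Params) 0 => iterBlockOf j b₀.src) (fun b₀ : PBond (⟨d + 1, L, m, K, hd, hL⟩ : Params) 0 => iterBlockOf j b₀.src)
    (Cf := Real.exp κH) (Cg := CG) (by positivity) hCG hδ₁0.le hδ₁G hδ₁H hQ hGb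
  -- `(D_λH_j)(Q_jG)`: pair bound at rate `δ` (p38 file 1's `holderBound_comp`; first factor r03's `holderBound_DHj_rateFree` at rate `δ_H > δ`)
  have h2 := holderBound_comp hρ hK (((((L : ℝ) ^ j) • (onE (LinearMap.funLeft ℝ ℝ (fun b : PBond (⟨d + 1, L, m, K, hd, hL⟩ : Params) 0 =>
              (⟨b.src.shift lam, b.dir⟩ : PBond (⟨d + 1, L, m, K, hd, hL⟩ : Params) 0))) - LinearMap.id) :
          BondSpace (⟨d + 1, L, m, K, hd, hL⟩ : Params) →ₗ[ℝ] BondSpace (⟨d + 1, L, m, K, hd, hL⟩ : Params))) ∘ₗ (tsV1 hc Λ' w).Hj) ((tsV1 hc Λ' w).Qv ∘ₗ GE (Domains.whole (P := (⟨d + 1, L, m, K, hd, hL⟩ : Params)) j hj') hc (w := fun _ => 1 * ((L : ℝ) ^ j) ^ (d + 1)) (fun _ => hw'))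
    (fun b : PBond (⟨d + 1, L, m, K, hd, hL⟩ : Params) j => b.src) (fun b₀ : PBond (⟨d + 1, L, m, K, hd, hL⟩ : Params) 0 => iterBlockOf j b₀.src) b₁ b₂ (iterBlockOf j b₁.src)
    (Cf := CH * (((supDist b₁.src b₂.src : ℕ) : ℝ) / (L : ℝ) ^ j) ^ α) (Cg := Real.exp κH * CG * K₁)
    (by positivity) (by positivity) hδ0.le hδδ₁ hδH' (fun y' => hH m K j hc hj Λ' w hw lam b₁ b₂ hdir hle y') h1
  -- `D_λG^{(n^{d+1})}` and `(D_λH_j)(Q_jG)` at the common rate `δ`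
  have h3 := holderBound_mono hρ (((((L : ℝ) ^ j) • (onE (LinearMap.funLeft ℝ ℝ (fun b : PBond (⟨d + 1, L, m, K, hd, hL⟩ : Params) 0 =>
              (⟨b.src.shift lam, b.dir⟩ : PBond (⟨d + 1, L, m, K, hd, hL⟩ : Params) 0))) - LinearMap.id) :
          BondSpace (⟨d + 1, L, m, K, hd, hL⟩ : Params) →ₗ[ℝ] BondSpace (⟨d + 1, L, m, K, hd, hL⟩ : Params))) ∘ₗ GE (Domains.whole (P := (⟨d + 1, L, m, K, hd, hL⟩ : Params)) j hj') hc (w := fun _ => 1 * ((L : ℝ) ^ j) ^ (d + 1)) (fun _ => hw'))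
    (fun b₀ : PBond (⟨d + 1, L, m, K, hd, hL⟩ : Params) 0 => iterBlockOf j b₀.src) b₁ b₂ (iterBlockOf j b₁.src) (C' := CD * (((supDist b₁.src b₂.src : ℕ) : ℝ) / (L : ℝ) ^ j) ^ α)
    (by positivity) le_rfl hδD' (hDG m K j hj' hc hw' lam b₁ b₂ hdir hle)
  have h4 := holderBound_mono hρ ((((((L : ℝ) ^ j) • (onE (LinearMap.funLeft ℝ ℝ (fun b : PBond (⟨d + 1, L, m, K, hd, hL⟩ : Params) 0 =>
              (⟨b.src.shift lam, b.dir⟩ : PBond (⟨d + 1, L, m, K, hd, hL⟩ : Params) 0))) - LinearMap.id) :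
          BondSpace (⟨d + 1, L, m, K, hd, hL⟩ : Params) →ₗ[ℝ] BondSpace (⟨d + 1, L, m, K, hd, hL⟩ : Params))) ∘ₗ (tsV1 hc Λ' w).Hj) ∘ₗ ((tsV1 hc Λ' w).Qv ∘ₗ GE (Domains.whole (P := (⟨d + 1, L, m, K, hd, hL⟩ : Params)) j hj') hc (w := fun _ => 1 * ((L : ℝ) ^ j) ^ (d + 1)) (fun _ => hw')))
    (fun b₀ : PBond (⟨d + 1, L, m, K, hd, hL⟩ : Params) 0 => iterBlockOf j b₀.src) b₁ b₂ (iterBlockOf j b₁.src)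
    (C' := CH * (((supDist b₁.src b₂.src : ℕ) : ℝ) / (L : ℝ) ^ j) ^ α * (Real.exp κH * CG * K₁) * K₂)
    (by positivity) (le_of_eq (by rw [hK₂])) le_rfl h2
  -- `D_λG̃_j = D_λG^{(n^{d+1})} − (D_λH_j)(Q_jG^{(n^{d+1})})`
  have hGt : ((((L : ℝ) ^ j) • (onE (LinearMap.funLeft ℝ ℝ (fun b : PBond (⟨d + 1, L, m, K, hd, hL⟩ : Params) 0 =>
              (⟨b.src.shift lam, b.dir⟩ : PBond (⟨d + 1, L, m, K, hd, hL⟩ : Params) 0))) - LinearMap.id) :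
          BondSpace (⟨d + 1, L, m, K, hd, hL⟩ : Params) →ₗ[ℝ] BondSpace (⟨d + 1, L, m, K, hd, hL⟩ : Params))) ∘ₗ (tsV1 hc Λ' w).Gt =
      ((((L : ℝ) ^ j) • (onE (LinearMap.funLeft ℝ ℝ (fun b : PBond (⟨d + 1, L, m, K, hd, hL⟩ : Params) 0 =>
              (⟨b.src.shift lam, b.dir⟩ : PBond (⟨d + 1, L, m, K, hd, hL⟩ : Params) 0))) - LinearMap.id) :
          BondSpace (⟨d + 1, L, m, K, hd, hL⟩ : Params) →ₗ[ℝ] BondSpace (⟨d + 1, L, m, K, hd, hL⟩ : Params))) ∘ₗ GE (Domains.whole (P := (⟨d + 1, L, m, K, hd, hL⟩ : Params)) j hj') hc (w := fun _ => 1 * ((L : ℝ) ^ j) ^ (d + 1)) (fun _ => hw') -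
        (((((L : ℝ) ^ j) • (onE (LinearMap.funLeft ℝ ℝ (fun b : PBond (⟨d + 1, L, m, K, hd, hL⟩ : Params) 0 =>
              (⟨b.src.shift lam, b.dir⟩ : PBond (⟨d + 1, L, m, K, hd, hL⟩ : Params) 0))) - LinearMap.id) :
          BondSpace (⟨d + 1, L, m, K, hd, hL⟩ : Params) →ₗ[ℝ] BondSpace (⟨d + 1, L, m, K, hd, hL⟩ : Params))) ∘ₗ (tsV1 hc Λ' w).Hj) ∘ₗ ((tsV1 hc Λ' w).Qv ∘ₗ GE (Domains.whole (P := (⟨d + 1, L, m, K, hd, hL⟩ : Params)) j hj') hc (w := fun _ => 1 * ((L : ℝ) ^ j) ^ (d + 1)) (fun _ => hw')) := by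
    rw [Gt_eq_comp_GE hc hj Λ' hw hw', LinearMap.sub_comp, LinearMap.id_comp, LinearMap.comp_sub, LinearMap.comp_assoc,
      ← LinearMap.comp_assoc ((tsV1 hc Λ' w).Qv ∘ₗ GE (Domains.whole (P := (⟨d + 1, L, m, K, hd, hL⟩ : Params)) j hj') hc (w := fun _ => 1 * ((L : ℝ) ^ j) ^ (d + 1)) (fun _ => hw'))]
  rw [hGt]
  have h5 := holderBound_sub (ρ := (fun t t' : Site (⟨d + 1, L, m, K, hd, hL⟩ : Params) j => torusSupNorm (Mk (⟨d + 1, L, m, K, hd, hL⟩ : Params) j) (rep (Mk (⟨d + 1, L, m, K, hd, hL⟩ : Params) j) t - rep (Mk (⟨d + 1, L, m, K, hd, hL⟩ : Params) j) t'))) _ _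
    (fun b₀ : PBond (⟨d + 1, L, m, K, hd, hL⟩ : Params) 0 => iterBlockOf j b₀.src) b₁ b₂ (iterBlockOf j b₁.src) h3 h4 y
  refine h5.trans (le_of_eq ?_)
  rw [hC]
  ring

/-! ## §3  The pair bound of `D_λG` (Proposition 2.5, the Hölder member of (1.111)) at the printed `α`-free rate -/

set_option maxHeartbeats 400000 in
open Classical in
/-- **PROPOSITION 2.5, THE HÖLDER CONTINUITY OF `∇G` FOR THE TWO-SCALE `G` AS A PAIR BOUND, WITH THE PRINTED `α`-FREE RATE** (at `c = L^j`,
weights `a₀n^{d+1} ≤ w ≤ a₁n^{d+1}`): there is `δ₂ > 0` depending on `d, L, a₀, a₁` only — NOT on `α` («This constant depends on d and L only») —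
and for every `0 ≤ α < 1` a `C_α ≥ 0` («O(1) depending on d and α») such that for every volume, `j + 1 ≤ m + K`, `Λ′`, weights in the window,
direction `λ`, fine bonds `b₁ = ⟨x, ν⟩`, `b₂ = ⟨x′, ν⟩` with `|x − x′|_∞ ≤ n` and unit site `y`:
`Σ_{b₀′ : y(b₀′₋) = y}|(D_λG)(e_{b₀′})_{b₁} − (D_λG)(e_{b₀′})_{b₂}| ≤ C_α·(|x − x′|_∞/n)^α·e^{−δ₂|y(x) − y|_T}` — the `_rateFree` twin of p38's
`…B6Prop25HolderTwoScaleV1.holderBound_DG_scaling` (same proof: (2.129) differentiated, p22's `G_eq_op_V1`; first factors by the pair bounds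
`holderBound_DK1_scaling`, `holderBound_DK2adj_scaling` (p38) and §1–§2 here; tails by p22's block bounds; composed by p38's pair calculus).
[cite: Balaban1984PropagatorsII, Prop. 2.5 p.246; Balaban1984PropagatorsI, (1.111) p.35] -/
theorem holderBound_DG_rateFree (d L : ℕ) (hd : 1 ≤ d + 1) (hL : Odd L ∧ 1 < L) {a₀ a₁ : ℝ} (ha₀ : 0 < a₀) (ha₁ : a₀ ≤ a₁) :
    ∃ δ : ℝ, 0 < δ ∧ ∀ α : ℝ, 0 ≤ α → α < 1 → ∃ C : ℝ, 0 ≤ C ∧ ∀ (m K : ℕ) (j : ℕ) (hc : ((L : ℝ) ^ j) ≠ 0)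
      (_hj : j + 1 ≤ (⟨d + 1, L, m, K, hd, hL⟩ : Params).m + (⟨d + 1, L, m, K, hd, hL⟩ : Params).K)
      (Λ' : Finset (Site (⟨d + 1, L, m, K, hd, hL⟩ : Params) (j + 1))) (w : CIdx j Λ' → ℝ)
      (_hw0 : ∀ i, a₀ * ((L : ℝ) ^ j) ^ (d + 1) ≤ w i) (_hw1 : ∀ i, w i ≤ a₁ * ((L : ℝ) ^ j) ^ (d + 1)) (lam : Fin (d + 1))
      (b₁ b₂ : PBond (⟨d + 1, L, m, K, hd, hL⟩ : Params) 0) (_hdir : b₁.dir = b₂.dir) (_hle : supDist b₁.src b₂.src ≤ L ^ j) (y : Site (⟨d + 1, L, m, K, hd, hL⟩ : Params) j),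
      ∑ b₀' ∈ univ.filter (fun b₀' : PBond (⟨d + 1, L, m, K, hd, hL⟩ : Params) 0 => iterBlockOf j b₀'.src = y),
          |(((((L : ℝ) ^ j) • (onE (LinearMap.funLeft ℝ ℝ (fun b : PBond (⟨d + 1, L, m, K, hd, hL⟩ : Params) 0 =>
              (⟨b.src.shift lam, b.dir⟩ : PBond (⟨d + 1, L, m, K, hd, hL⟩ : Params) 0))) - LinearMap.id) :
          BondSpace (⟨d + 1, L, m, K, hd, hL⟩ : Params) →ₗ[ℝ] BondSpace (⟨d + 1, L, m, K, hd, hL⟩ : Params))) ∘ₗ (tsV1 hc Λ' w).G) (EuclideanSpace.single b₀' (1 : ℝ)) b₁ -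
           (((((L : ℝ) ^ j) • (onE (LinearMap.funLeft ℝ ℝ (fun b : PBond (⟨d + 1, L, m, K, hd, hL⟩ : Params) 0 =>
              (⟨b.src.shift lam, b.dir⟩ : PBond (⟨d + 1, L, m, K, hd, hL⟩ : Params) 0))) - LinearMap.id) :
          BondSpace (⟨d + 1, L, m, K, hd, hL⟩ : Params) →ₗ[ℝ] BondSpace (⟨d + 1, L, m, K, hd, hL⟩ : Params))) ∘ₗ (tsV1 hc Λ' w).G) (EuclideanSpace.single b₀' (1 : ℝ)) b₂| ≤
        C * (((supDist b₁.src b₂.src : ℕ) : ℝ) / (L : ℝ) ^ j) ^ α * Real.exp (-(δ * torusSupNorm (Mk (⟨d + 1, L, m, K, hd, hL⟩ : Params) j)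
            (rep (Mk (⟨d + 1, L, m, K, hd, hL⟩ : Params) j) (iterBlockOf j b₁.src) - rep (Mk (⟨d + 1, L, m, K, hd, hL⟩ : Params) j) y))) := by
  obtain ⟨δ₁, hδ₁, C₁, hC₁, hDK1⟩ := holderBound_DK1_scaling d L hd hL
  obtain ⟨δ₂, hδ₂, C₂, hC₂, hK2⟩ := blockBound_K2_scaling d L hd hL
  obtain ⟨δ₃, hδ₃, C₃, hC₃, hDK2a⟩ := holderBound_DK2adj_scaling d L hd hL
  obtain ⟨δ₄, hδ₄, C₄, hC₄, hHCH⟩ := blockBound_HjCtHj_scaling d L hd hL ha₀ ha₁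
  obtain ⟨δ₅, hδ₅, C₅, hC₅, hGt⟩ := blockBound_Gt_scaling d L hd hL
  obtain ⟨δ₆, hδ₆, HDHCH⟩ := holderBound_DHjCtHj_rateFree d L hd hL ha₀ ha₁
  obtain ⟨δ₇, hδ₇, HDGt⟩ := holderBound_DGt_rateFree d L hd hL
  -- the common `α`-free rate
  set δ₀ : ℝ := min (min (min δ₁ δ₂) (min δ₃ δ₄)) (min (min δ₅ δ₆) δ₇) with hδ₀
  have hδ₀0 : 0 < δ₀ := lt_min (lt_min (lt_min hδ₁ hδ₂) (lt_min hδ₃ hδ₄)) (lt_min (lt_min hδ₅ hδ₆) hδ₇)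
  have h01 : δ₀ ≤ δ₁ := (min_le_left _ _).trans ((min_le_left _ _).trans (min_le_left _ _))
  have h02 : δ₀ ≤ δ₂ := (min_le_left _ _).trans ((min_le_left _ _).trans (min_le_right _ _))
  have h03 : δ₀ ≤ δ₃ := (min_le_left _ _).trans ((min_le_right _ _).trans (min_le_left _ _))
  have h04 : δ₀ ≤ δ₄ := (min_le_left _ _).trans ((min_le_right _ _).trans (min_le_right _ _))
  have h05 : δ₀ ≤ δ₅ := (min_le_right _ _).trans ((min_le_left _ _).trans (min_le_left _ _))
  have h06 : δ₀ ≤ δ₆ := (min_le_right _ _).trans ((min_le_left _ _).trans (min_le_right _ _))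
  have h07 : δ₀ ≤ δ₇ := (min_le_right _ _).trans (min_le_right _ _)
  -- the work rates `δ₀`, `δ₀/2`, `δ₀/4` (all independent of `α`) and their lattice constants
  set Ka : ℝ := latticeConst (d + 1) (δ₀ - δ₀ / 2) with hKa
  have hKa0 : 0 ≤ Ka := latticeConst_nonneg _ (by linarith)
  set Kb : ℝ := latticeConst (d + 1) (δ₀ - δ₀ / 4) with hKb
  have hKb0 : 0 ≤ Kb := latticeConst_nonneg _ (by linarith)
  have hL0 : 0 < L := by have := hL.2; omega
  have hLp : (0 : ℝ) < L := by exact_mod_cast hL0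
  refine ⟨δ₀ / 4, by positivity, fun α hα0 hα1 => ?_⟩
  obtain ⟨C₆, hC₆, hDHCH⟩ := HDHCH α hα0 hα1
  obtain ⟨C₇, hC₇, hDGt⟩ := HDGt α hα0 hα1
  set C : ℝ := C₁ + ((C₇ + C₆) * (1 + C₂) * Ka + C₃ * ((C₅ + C₄) * (1 + C₂) * Ka) * Kb) with hC
  have hC0 : 0 ≤ C := by positivity
  refine ⟨C, hC0, ?_⟩
  intro m K j hc hj Λ' w hw0 hw1 lam b₁ b₂ hdir hle y
  have hw : ∀ i, 0 < w i := fun i => lt_of_lt_of_le (by positivity) (hw0 i)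
  have hj' : j ≤ m + K := Nat.le_of_succ_le hj
  have hLj : (0 : ℝ) < (L : ℝ) ^ j := by positivity
  have ht0 : 0 ≤ (((supDist b₁.src b₂.src : ℕ) : ℝ) / (L : ℝ) ^ j) := by positivity
  have ht1 : (((supDist b₁.src b₂.src : ℕ) : ℝ) / (L : ℝ) ^ j) ≤ 1 := by
    rw [div_le_one hLj]
    exact_mod_cast hle
  have htα : (((supDist b₁.src b₂.src : ℕ) : ℝ) / (L : ℝ) ^ j) ≤ (((supDist b₁.src b₂.src : ℕ) : ℝ) / (L : ℝ) ^ j) ^ α := self_le_rpow_of_le_one' ht0 ht1 hα1.le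
  have htα0 : 0 ≤ (((supDist b₁.src b₂.src : ℕ) : ℝ) / (L : ℝ) ^ j) ^ α := Real.rpow_nonneg ht0 _
  have hρ : IsPseudoDist (fun t t' : Site (⟨d + 1, L, m, K, hd, hL⟩ : Params) j => torusSupNorm (Mk (⟨d + 1, L, m, K, hd, hL⟩ : Params) j) (rep (Mk (⟨d + 1, L, m, K, hd, hL⟩ : Params) j) t - rep (Mk (⟨d + 1, L, m, K, hd, hL⟩ : Params) j) t')) := torusDist_isPseudoDist (Mk (⟨d + 1, L, m, K, hd, hL⟩ : Params) j)
  have hK : SumBound (fun t t' : Site (⟨d + 1, L, m, K, hd, hL⟩ : Params) j => torusSupNorm (Mk (⟨d + 1, L, m, K, hd, hL⟩ : Params) j) (rep (Mk (⟨d + 1, L, m, K, hd, hL⟩ : Params) j) t - rep (Mk (⟨d + 1, L, m, K, hd, hL⟩ : Params) j) t')) (fun a => latticeConst (d + 1) a) := torusDist_sumBound (Mk (⟨d + 1, L, m, K, hd, hL⟩ : Params) j)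
  -- (a) the ingredients: pair bounds at the rate `δ₀` (the Lipschitz ones via `t ≤ t^α`; `D_λK₁` directly at `δ₀/4`), block bounds at `δ₀`
  have pDK1 := holderBound_mono hρ (((((L : ℝ) ^ j) • (onE (LinearMap.funLeft ℝ ℝ (fun b : PBond (⟨d + 1, L, m, K, hd, hL⟩ : Params) 0 =>
              (⟨b.src.shift lam, b.dir⟩ : PBond (⟨d + 1, L, m, K, hd, hL⟩ : Params) 0))) - LinearMap.id) :
          BondSpace (⟨d + 1, L, m, K, hd, hL⟩ : Params) →ₗ[ℝ] BondSpace (⟨d + 1, L, m, K, hd, hL⟩ : Params))) ∘ₗ (tsV1 hc Λ' w).K1) (fun b₀ : PBond (⟨d + 1, L, m, K, hd, hL⟩ : Params) 0 => iterBlockOf j b₀.src) b₁ b₂ (iterBlockOf j b₁.src)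
    (C := C₁ * (((supDist b₁.src b₂.src : ℕ) : ℝ) / (L : ℝ) ^ j)) (C' := C₁ * (((supDist b₁.src b₂.src : ℕ) : ℝ) / (L : ℝ) ^ j) ^ α) (mul_nonneg hC₁ htα0) (mul_le_mul_of_nonneg_left htα hC₁)
    (show δ₀ / 4 ≤ δ₁ by linarith) (hDK1 m K j hc hj Λ' w hw lam b₁ b₂ hdir hle)
  have bK2 := blockBound_mono hρ (tsV1 hc Λ' w).K2 (fun b₀ : PBond (⟨d + 1, L, m, K, hd, hL⟩ : Params) 0 => iterBlockOf j b₀.src) (fun b₀ : PBond (⟨d + 1, L, m, K, hd, hL⟩ : Params) 0 => iterBlockOf j b₀.src)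
    hC₂ le_rfl h02 (hK2 m K j hc hj Λ' w hw)
  have pDK2a := holderBound_mono hρ (((((L : ℝ) ^ j) • (onE (LinearMap.funLeft ℝ ℝ (fun b : PBond (⟨d + 1, L, m, K, hd, hL⟩ : Params) 0 =>
              (⟨b.src.shift lam, b.dir⟩ : PBond (⟨d + 1, L, m, K, hd, hL⟩ : Params) 0))) - LinearMap.id) :
          BondSpace (⟨d + 1, L, m, K, hd, hL⟩ : Params) →ₗ[ℝ] BondSpace (⟨d + 1, L, m, K, hd, hL⟩ : Params))) ∘ₗ LinearMap.adjoint (tsV1 hc Λ' w).K2) (fun b₀ : PBond (⟨d + 1, L, m, K, hd, hL⟩ : Params) 0 => iterBlockOf j b₀.src) b₁ b₂ (iterBlockOf j b₁.src)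
    (C := C₃ * (((supDist b₁.src b₂.src : ℕ) : ℝ) / (L : ℝ) ^ j)) (C' := C₃ * (((supDist b₁.src b₂.src : ℕ) : ℝ) / (L : ℝ) ^ j) ^ α) (mul_nonneg hC₃ htα0) (mul_le_mul_of_nonneg_left htα hC₃)
    h03 (hDK2a m K j hc hj Λ' w hw lam b₁ b₂ hdir hle)
  have bHCH := blockBound_mono hρ ((tsV1 hc Λ' w).Hj ∘ₗ (tsV1 hc Λ' w).Ct ∘ₗ LinearMap.adjoint (tsV1 hc Λ' w).Hj)
    (fun b₀ : PBond (⟨d + 1, L, m, K, hd, hL⟩ : Params) 0 => iterBlockOf j b₀.src) (fun b₀ : PBond (⟨d + 1, L, m, K, hd, hL⟩ : Params) 0 => iterBlockOf j b₀.src) hC₄ le_rfl h04 (hHCH m K j hc hj Λ' w hw0 hw1)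
  have bGt := blockBound_mono hρ (tsV1 hc Λ' w).Gt (fun b₀ : PBond (⟨d + 1, L, m, K, hd, hL⟩ : Params) 0 => iterBlockOf j b₀.src) (fun b₀ : PBond (⟨d + 1, L, m, K, hd, hL⟩ : Params) 0 => iterBlockOf j b₀.src)
    hC₅ le_rfl h05 (hGt m K j hc hj Λ' w hw)
  have pDHCH := holderBound_mono hρ (((((L : ℝ) ^ j) • (onE (LinearMap.funLeft ℝ ℝ (fun b : PBond (⟨d + 1, L, m, K, hd, hL⟩ : Params) 0 =>
              (⟨b.src.shift lam, b.dir⟩ : PBond (⟨d + 1, L, m, K, hd, hL⟩ : Params) 0))) - LinearMap.id) :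
          BondSpace (⟨d + 1, L, m, K, hd, hL⟩ : Params) →ₗ[ℝ] BondSpace (⟨d + 1, L, m, K, hd, hL⟩ : Params))) ∘ₗ ((tsV1 hc Λ' w).Hj ∘ₗ (tsV1 hc Λ' w).Ct ∘ₗ LinearMap.adjoint (tsV1 hc Λ' w).Hj))
    (fun b₀ : PBond (⟨d + 1, L, m, K, hd, hL⟩ : Params) 0 => iterBlockOf j b₀.src) b₁ b₂ (iterBlockOf j b₁.src) (C' := C₆ * (((supDist b₁.src b₂.src : ℕ) : ℝ) / (L : ℝ) ^ j) ^ α) (mul_nonneg hC₆ htα0) le_rfl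
    h06 (hDHCH m K j hc hj Λ' w hw0 hw1 lam b₁ b₂ hdir hle)
  have pDGt := holderBound_mono hρ (((((L : ℝ) ^ j) • (onE (LinearMap.funLeft ℝ ℝ (fun b : PBond (⟨d + 1, L, m, K, hd, hL⟩ : Params) 0 =>
              (⟨b.src.shift lam, b.dir⟩ : PBond (⟨d + 1, L, m, K, hd, hL⟩ : Params) 0))) - LinearMap.id) :
          BondSpace (⟨d + 1, L, m, K, hd, hL⟩ : Params) →ₗ[ℝ] BondSpace (⟨d + 1, L, m, K, hd, hL⟩ : Params))) ∘ₗ (tsV1 hc Λ' w).Gt)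
    (fun b₀ : PBond (⟨d + 1, L, m, K, hd, hL⟩ : Params) 0 => iterBlockOf j b₀.src) b₁ b₂ (iterBlockOf j b₁.src) (C' := C₇ * (((supDist b₁.src b₂.src : ℕ) : ℝ) / (L : ℝ) ^ j) ^ α) (mul_nonneg hC₇ htα0) le_rfl
    h07 (hDGt m K j hc hj Λ' w hw lam b₁ b₂ hdir hle)
  have bid := blockBound_id hρ (fun b₀ : PBond (⟨d + 1, L, m, K, hd, hL⟩ : Params) 0 => iterBlockOf j b₀.src) δ₀
  -- (b) `I − K₂`, `M = G̃_j + H_jC̃H_j*`, `D_λM`, `N = M(I − K₂)`, `(D_λM)(I − K₂)`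
  have bIK2 := blockBound_sub (ρ := (fun t t' : Site (⟨d + 1, L, m, K, hd, hL⟩ : Params) j => torusSupNorm (Mk (⟨d + 1, L, m, K, hd, hL⟩ : Params) j) (rep (Mk (⟨d + 1, L, m, K, hd, hL⟩ : Params) j) t - rep (Mk (⟨d + 1, L, m, K, hd, hL⟩ : Params) j) t'))) _ _
    (fun b₀ : PBond (⟨d + 1, L, m, K, hd, hL⟩ : Params) 0 => iterBlockOf j b₀.src) (fun b₀ : PBond (⟨d + 1, L, m, K, hd, hL⟩ : Params) 0 => iterBlockOf j b₀.src) bid bK2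
  have bM := blockBound_add (ρ := (fun t t' : Site (⟨d + 1, L, m, K, hd, hL⟩ : Params) j => torusSupNorm (Mk (⟨d + 1, L, m, K, hd, hL⟩ : Params) j) (rep (Mk (⟨d + 1, L, m, K, hd, hL⟩ : Params) j) t - rep (Mk (⟨d + 1, L, m, K, hd, hL⟩ : Params) j) t'))) _ _
    (fun b₀ : PBond (⟨d + 1, L, m, K, hd, hL⟩ : Params) 0 => iterBlockOf j b₀.src) (fun b₀ : PBond (⟨d + 1, L, m, K, hd, hL⟩ : Params) 0 => iterBlockOf j b₀.src) bGt bHCH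
  have pDM := holderBound_add (ρ := (fun t t' : Site (⟨d + 1, L, m, K, hd, hL⟩ : Params) j => torusSupNorm (Mk (⟨d + 1, L, m, K, hd, hL⟩ : Params) j) (rep (Mk (⟨d + 1, L, m, K, hd, hL⟩ : Params) j) t - rep (Mk (⟨d + 1, L, m, K, hd, hL⟩ : Params) j) t'))) _ _
    (fun b₀ : PBond (⟨d + 1, L, m, K, hd, hL⟩ : Params) 0 => iterBlockOf j b₀.src) b₁ b₂ (iterBlockOf j b₁.src) pDGt pDHCH
  have bN := blockBound_comp hρ hK ((tsV1 hc Λ' w).Gt + (tsV1 hc Λ' w).Hj ∘ₗ (tsV1 hc Λ' w).Ct ∘ₗ LinearMap.adjoint (tsV1 hc Λ' w).Hj)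
    (LinearMap.id - (tsV1 hc Λ' w).K2)
    (fun b₀ : PBond (⟨d + 1, L, m, K, hd, hL⟩ : Params) 0 => iterBlockOf j b₀.src) (fun b₀ : PBond (⟨d + 1, L, m, K, hd, hL⟩ : Params) 0 => iterBlockOf j b₀.src) (fun b₀ : PBond (⟨d + 1, L, m, K, hd, hL⟩ : Params) 0 => iterBlockOf j b₀.src)
    (Cf := C₅ + C₄) (Cg := 1 + C₂) (add_nonneg hC₅ hC₄) (add_nonneg zero_le_one hC₂)
    (show (0 : ℝ) ≤ δ₀ / 2 by linarith) (show δ₀ / 2 ≤ δ₀ by linarith) (show δ₀ / 2 < δ₀ by linarith) bM bIK2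
  have pDN := holderBound_comp hρ hK
    (((((L : ℝ) ^ j) • (onE (LinearMap.funLeft ℝ ℝ (fun b : PBond (⟨d + 1, L, m, K, hd, hL⟩ : Params) 0 =>
              (⟨b.src.shift lam, b.dir⟩ : PBond (⟨d + 1, L, m, K, hd, hL⟩ : Params) 0))) - LinearMap.id) :
          BondSpace (⟨d + 1, L, m, K, hd, hL⟩ : Params) →ₗ[ℝ] BondSpace (⟨d + 1, L, m, K, hd, hL⟩ : Params))) ∘ₗ (tsV1 hc Λ' w).Gt + ((((L : ℝ) ^ j) • (onE (LinearMap.funLeft ℝ ℝ (fun b : PBond (⟨d + 1, L, m, K, hd, hL⟩ : Params) 0 =>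
              (⟨b.src.shift lam, b.dir⟩ : PBond (⟨d + 1, L, m, K, hd, hL⟩ : Params) 0))) - LinearMap.id) :
          BondSpace (⟨d + 1, L, m, K, hd, hL⟩ : Params) →ₗ[ℝ] BondSpace (⟨d + 1, L, m, K, hd, hL⟩ : Params))) ∘ₗ ((tsV1 hc Λ' w).Hj ∘ₗ (tsV1 hc Λ' w).Ct ∘ₗ LinearMap.adjoint (tsV1 hc Λ' w).Hj))
    (LinearMap.id - (tsV1 hc Λ' w).K2)
    (fun b₀ : PBond (⟨d + 1, L, m, K, hd, hL⟩ : Params) 0 => iterBlockOf j b₀.src) (fun b₀ : PBond (⟨d + 1, L, m, K, hd, hL⟩ : Params) 0 => iterBlockOf j b₀.src) b₁ b₂ (iterBlockOf j b₁.src)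
    (Cf := C₇ * (((supDist b₁.src b₂.src : ℕ) : ℝ) / (L : ℝ) ^ j) ^ α + C₆ * (((supDist b₁.src b₂.src : ℕ) : ℝ) / (L : ℝ) ^ j) ^ α) (Cg := 1 + C₂) (add_nonneg (mul_nonneg hC₇ htα0) (mul_nonneg hC₆ htα0))
    (add_nonneg zero_le_one hC₂) (show (0 : ℝ) ≤ δ₀ / 2 by linarith) (show δ₀ / 2 ≤ δ₀ by linarith)
    (show δ₀ / 2 < δ₀ by linarith) pDM bIK2
  -- (c) `(D_λK₂*)·N` and everything at the rate `δ₀/4`; the difference; the sum with `D_λK₁`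
  have pX := holderBound_comp hρ hK (((((L : ℝ) ^ j) • (onE (LinearMap.funLeft ℝ ℝ (fun b : PBond (⟨d + 1, L, m, K, hd, hL⟩ : Params) 0 =>
              (⟨b.src.shift lam, b.dir⟩ : PBond (⟨d + 1, L, m, K, hd, hL⟩ : Params) 0))) - LinearMap.id) :
          BondSpace (⟨d + 1, L, m, K, hd, hL⟩ : Params) →ₗ[ℝ] BondSpace (⟨d + 1, L, m, K, hd, hL⟩ : Params))) ∘ₗ LinearMap.adjoint (tsV1 hc Λ' w).K2)
    (((tsV1 hc Λ' w).Gt + (tsV1 hc Λ' w).Hj ∘ₗ (tsV1 hc Λ' w).Ct ∘ₗ LinearMap.adjoint (tsV1 hc Λ' w).Hj) ∘ₗ (LinearMap.id - (tsV1 hc Λ' w).K2))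
    (fun b₀ : PBond (⟨d + 1, L, m, K, hd, hL⟩ : Params) 0 => iterBlockOf j b₀.src) (fun b₀ : PBond (⟨d + 1, L, m, K, hd, hL⟩ : Params) 0 => iterBlockOf j b₀.src) b₁ b₂ (iterBlockOf j b₁.src)
    (Cf := C₃ * (((supDist b₁.src b₂.src : ℕ) : ℝ) / (L : ℝ) ^ j) ^ α) (Cg := (C₅ + C₄) * (1 + C₂) * Ka) (mul_nonneg hC₃ htα0)
    (mul_nonneg (mul_nonneg (add_nonneg hC₅ hC₄) (add_nonneg zero_le_one hC₂)) hKa0)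
    (show (0 : ℝ) ≤ δ₀ / 4 by linarith) (show δ₀ / 4 ≤ δ₀ / 2 by linarith)
    (show δ₀ / 4 < δ₀ by linarith) pDK2a bN
  have pDN' := holderBound_mono hρ
    ((((((L : ℝ) ^ j) • (onE (LinearMap.funLeft ℝ ℝ (fun b : PBond (⟨d + 1, L, m, K, hd, hL⟩ : Params) 0 =>
              (⟨b.src.shift lam, b.dir⟩ : PBond (⟨d + 1, L, m, K, hd, hL⟩ : Params) 0))) - LinearMap.id) :
          BondSpace (⟨d + 1, L, m, K, hd, hL⟩ : Params) →ₗ[ℝ] BondSpace (⟨d + 1, L, m, K, hd, hL⟩ : Params))) ∘ₗ (tsV1 hc Λ' w).Gt + ((((L : ℝ) ^ j) • (onE (LinearMap.funLeft ℝ ℝ (fun b : PBond (⟨d + 1, L, m, K, hd, hL⟩ : Params) 0 =>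
              (⟨b.src.shift lam, b.dir⟩ : PBond (⟨d + 1, L, m, K, hd, hL⟩ : Params) 0))) - LinearMap.id) :
          BondSpace (⟨d + 1, L, m, K, hd, hL⟩ : Params) →ₗ[ℝ] BondSpace (⟨d + 1, L, m, K, hd, hL⟩ : Params))) ∘ₗ ((tsV1 hc Λ' w).Hj ∘ₗ (tsV1 hc Λ' w).Ct ∘ₗ LinearMap.adjoint (tsV1 hc Λ' w).Hj)) ∘ₗ
      (LinearMap.id - (tsV1 hc Λ' w).K2))
    (fun b₀ : PBond (⟨d + 1, L, m, K, hd, hL⟩ : Params) 0 => iterBlockOf j b₀.src) b₁ b₂ (iterBlockOf j b₁.src)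
    (C' := (C₇ * (((supDist b₁.src b₂.src : ℕ) : ℝ) / (L : ℝ) ^ j) ^ α + C₆ * (((supDist b₁.src b₂.src : ℕ) : ℝ) / (L : ℝ) ^ j) ^ α) * (1 + C₂) * Ka)
    (mul_nonneg (mul_nonneg (add_nonneg (mul_nonneg hC₇ htα0) (mul_nonneg hC₆ htα0)) (add_nonneg zero_le_one hC₂)) hKa0)
    (le_of_eq (by rw [hKa]))
    (show δ₀ / 4 ≤ δ₀ / 2 by linarith) pDN
  have pX' := holderBound_mono hρ
    ((((((L : ℝ) ^ j) • (onE (LinearMap.funLeft ℝ ℝ (fun b : PBond (⟨d + 1, L, m, K, hd, hL⟩ : Params) 0 =>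
              (⟨b.src.shift lam, b.dir⟩ : PBond (⟨d + 1, L, m, K, hd, hL⟩ : Params) 0))) - LinearMap.id) :
          BondSpace (⟨d + 1, L, m, K, hd, hL⟩ : Params) →ₗ[ℝ] BondSpace (⟨d + 1, L, m, K, hd, hL⟩ : Params))) ∘ₗ LinearMap.adjoint (tsV1 hc Λ' w).K2) ∘ₗ
      (((tsV1 hc Λ' w).Gt + (tsV1 hc Λ' w).Hj ∘ₗ (tsV1 hc Λ' w).Ct ∘ₗ LinearMap.adjoint (tsV1 hc Λ' w).Hj) ∘ₗ (LinearMap.id - (tsV1 hc Λ' w).K2)))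
    (fun b₀ : PBond (⟨d + 1, L, m, K, hd, hL⟩ : Params) 0 => iterBlockOf j b₀.src) b₁ b₂ (iterBlockOf j b₁.src)
    (C' := C₃ * (((supDist b₁.src b₂.src : ℕ) : ℝ) / (L : ℝ) ^ j) ^ α * ((C₅ + C₄) * (1 + C₂) * Ka) * Kb)
    (mul_nonneg (mul_nonneg (mul_nonneg hC₃ htα0) (mul_nonneg (mul_nonneg (add_nonneg hC₅ hC₄) (add_nonneg zero_le_one hC₂)) hKa0)) hKb0)
    (le_of_eq (by rw [hKb])) le_rfl pX
  have pY := holderBound_sub (ρ := (fun t t' : Site (⟨d + 1, L, m, K, hd, hL⟩ : Params) j => torusSupNorm (Mk (⟨d + 1, L, m, K, hd, hL⟩ : Params) j) (rep (Mk (⟨d + 1, L, m, K, hd, hL⟩ : Params) j) t - rep (Mk (⟨d + 1, L, m, K, hd, hL⟩ : Params) j) t'))) _ _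
    (fun b₀ : PBond (⟨d + 1, L, m, K, hd, hL⟩ : Params) 0 => iterBlockOf j b₀.src) b₁ b₂ (iterBlockOf j b₁.src) pDN' pX'
  have ptot := holderBound_add (ρ := (fun t t' : Site (⟨d + 1, L, m, K, hd, hL⟩ : Params) j => torusSupNorm (Mk (⟨d + 1, L, m, K, hd, hL⟩ : Params) j) (rep (Mk (⟨d + 1, L, m, K, hd, hL⟩ : Params) j) t - rep (Mk (⟨d + 1, L, m, K, hd, hL⟩ : Params) j) t'))) _ _
    (fun b₀ : PBond (⟨d + 1, L, m, K, hd, hL⟩ : Params) 0 => iterBlockOf j b₀.src) b₁ b₂ (iterBlockOf j b₁.src) pDK1 pY y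
  -- (d) the algebra: `D_λG = D_λK₁ + ((D_λM)(I − K₂) − (D_λK₂*)(M(I − K₂)))` (p22 file 10, verbatim)
  have hadj : LinearMap.adjoint (LinearMap.id - (tsV1 hc Λ' w).K2) = LinearMap.id - LinearMap.adjoint (tsV1 hc Λ' w).K2 := by
    rw [map_sub, LinearMap.adjoint_id]
  have hDG : ((((L : ℝ) ^ j) • (onE (LinearMap.funLeft ℝ ℝ (fun b : PBond (⟨d + 1, L, m, K, hd, hL⟩ : Params) 0 =>
              (⟨b.src.shift lam, b.dir⟩ : PBond (⟨d + 1, L, m, K, hd, hL⟩ : Params) 0))) - LinearMap.id) :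
          BondSpace (⟨d + 1, L, m, K, hd, hL⟩ : Params) →ₗ[ℝ] BondSpace (⟨d + 1, L, m, K, hd, hL⟩ : Params))) ∘ₗ (tsV1 hc Λ' w).G =
      ((((L : ℝ) ^ j) • (onE (LinearMap.funLeft ℝ ℝ (fun b : PBond (⟨d + 1, L, m, K, hd, hL⟩ : Params) 0 =>
              (⟨b.src.shift lam, b.dir⟩ : PBond (⟨d + 1, L, m, K, hd, hL⟩ : Params) 0))) - LinearMap.id) :
          BondSpace (⟨d + 1, L, m, K, hd, hL⟩ : Params) →ₗ[ℝ] BondSpace (⟨d + 1, L, m, K, hd, hL⟩ : Params))) ∘ₗ (tsV1 hc Λ' w).K1 +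
        ((((((L : ℝ) ^ j) • (onE (LinearMap.funLeft ℝ ℝ (fun b : PBond (⟨d + 1, L, m, K, hd, hL⟩ : Params) 0 =>
              (⟨b.src.shift lam, b.dir⟩ : PBond (⟨d + 1, L, m, K, hd, hL⟩ : Params) 0))) - LinearMap.id) :
          BondSpace (⟨d + 1, L, m, K, hd, hL⟩ : Params) →ₗ[ℝ] BondSpace (⟨d + 1, L, m, K, hd, hL⟩ : Params))) ∘ₗ (tsV1 hc Λ' w).Gt + ((((L : ℝ) ^ j) • (onE (LinearMap.funLeft ℝ ℝ (fun b : PBond (⟨d + 1, L, m, K, hd, hL⟩ : Params) 0 =>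
              (⟨b.src.shift lam, b.dir⟩ : PBond (⟨d + 1, L, m, K, hd, hL⟩ : Params) 0))) - LinearMap.id) :
          BondSpace (⟨d + 1, L, m, K, hd, hL⟩ : Params) →ₗ[ℝ] BondSpace (⟨d + 1, L, m, K, hd, hL⟩ : Params))) ∘ₗ ((tsV1 hc Λ' w).Hj ∘ₗ (tsV1 hc Λ' w).Ct ∘ₗ LinearMap.adjoint (tsV1 hc Λ' w).Hj)) ∘ₗ
            (LinearMap.id - (tsV1 hc Λ' w).K2) -
          (((((L : ℝ) ^ j) • (onE (LinearMap.funLeft ℝ ℝ (fun b : PBond (⟨d + 1, L, m, K, hd, hL⟩ : Params) 0 =>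
              (⟨b.src.shift lam, b.dir⟩ : PBond (⟨d + 1, L, m, K, hd, hL⟩ : Params) 0))) - LinearMap.id) :
          BondSpace (⟨d + 1, L, m, K, hd, hL⟩ : Params) →ₗ[ℝ] BondSpace (⟨d + 1, L, m, K, hd, hL⟩ : Params))) ∘ₗ LinearMap.adjoint (tsV1 hc Λ' w).K2) ∘ₗ
            (((tsV1 hc Λ' w).Gt + (tsV1 hc Λ' w).Hj ∘ₗ (tsV1 hc Λ' w).Ct ∘ₗ LinearMap.adjoint (tsV1 hc Λ' w).Hj) ∘ₗ (LinearMap.id - (tsV1 hc Λ' w).K2))) := by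
    rw [G_eq_op_V1 hc hj Λ' hw, hadj]
    refine LinearMap.ext fun v => ?_
    simp only [LinearMap.comp_apply, LinearMap.add_apply, LinearMap.sub_apply, LinearMap.id_apply, map_add, map_sub]
    abel
  rw [hDG]
  refine ptot.trans (le_of_eq ?_)
  rw [hC]
  ring

/-! ## §4  The member `‖ζ∇GJ‖_α` of (1.111) in the printed shape, at the printed `α`-free rate -/

open Classical in
/-- **PROPOSITION 2.5, THE MEMBER `‖ζ∇GJ‖_α` OF (1.111) IN THE PRINTED SHAPE WITH THE PRINTED `α`-FREE RATE** for the genuine two-scale `G` of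
(2.90), `Λ′` arbitrary (at `c = L^j`, weights `a₀n^{d+1} ≤ w ≤ a₁n^{d+1}`): there is `δ₂ > 0` depending on `d, L, a₀, a₁` only (NOT on `α`) and for
every `0 ≤ α < 1` a `C_α ≥ 0` such that for every volume, `j + 1 ≤ m + K`, `Λ′`, weights in the window, direction `λ`, radius `r ≥ 0`, every fine
bond field `J` supported on the fine bonds over the unit sites within `r` of `y′` with `|J| ≤ X`, every cut-off `ζ` on the fine sites supported over
the unit sites within `r` of `y` with `|ζ| ≤ Z₀`, and every pair of fine bonds `b₁ = ⟨x, ν⟩`, `b₂ = ⟨x′, ν⟩` with `|x − x′|_∞ ≤ n`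
(`t = |x − x′|_∞/n`) and `|ζ(x) − ζ(x′)| ≤ Z_h·t^α`:
`|ζ(x)·n((GJ)(b₁ + e_λ) − (GJ)(b₁)) − ζ(x′)·n((GJ)(b₂ + e_λ) − (GJ)(b₂))| ≤ C_α·e^{(1+2δ₂)(r+1)}·e^{−δ₂|y − y′|_T}·(Z_h + Z₀)·X·t^α` — the
`_rateFree` twin of p38's `…B6Prop25HolderTwoScaleV1.prop25_ineq111_grad` (same proof; §3 for the pair part, p22's `blockBound_DG_scaling` for the
sup part, p38's `abs_cutoff_pairDiff_le`). [cite: Balaban1984PropagatorsII, Prop. 2.5 p.246; Balaban1984PropagatorsI, (1.109), (1.111) p.35] -/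
theorem prop25_ineq111_grad_rateFree (d L : ℕ) (hd : 1 ≤ d + 1) (hL : Odd L ∧ 1 < L) {a₀ a₁ : ℝ} (ha₀ : 0 < a₀) (ha₁ : a₀ ≤ a₁) :
    ∃ δ : ℝ, 0 < δ ∧ ∀ α : ℝ, 0 ≤ α → α < 1 → ∃ C : ℝ, 0 ≤ C ∧ ∀ (m K : ℕ) (j : ℕ) (hc : ((L : ℝ) ^ j) ≠ 0)
      (_hj : j + 1 ≤ (⟨d + 1, L, m, K, hd, hL⟩ : Params).m + (⟨d + 1, L, m, K, hd, hL⟩ : Params).K)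
      (Λ' : Finset (Site (⟨d + 1, L, m, K, hd, hL⟩ : Params) (j + 1))) (w : CIdx j Λ' → ℝ)
      (_hw0 : ∀ i, a₀ * ((L : ℝ) ^ j) ^ (d + 1) ≤ w i) (_hw1 : ∀ i, w i ≤ a₁ * ((L : ℝ) ^ j) ^ (d + 1)) (lam : Fin (d + 1))
      (r : ℝ) (_hr : 0 ≤ r) (J : BondSpace (⟨d + 1, L, m, K, hd, hL⟩ : Params)) (X : ℝ) (_hX : 0 ≤ X) (y y' : Site (⟨d + 1, L, m, K, hd, hL⟩ : Params) j)
      (_hsupp : ∀ b : PBond (⟨d + 1, L, m, K, hd, hL⟩ : Params) 0, J b ≠ 0 →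
        torusSupNorm (Mk (⟨d + 1, L, m, K, hd, hL⟩ : Params) j) (rep (Mk (⟨d + 1, L, m, K, hd, hL⟩ : Params) j) (iterBlockOf j b.src) - rep (Mk (⟨d + 1, L, m, K, hd, hL⟩ : Params) j) y') ≤ r)
      (_hJ : ∀ b : PBond (⟨d + 1, L, m, K, hd, hL⟩ : Params) 0, |J b| ≤ X)
      (ζ : Site (⟨d + 1, L, m, K, hd, hL⟩ : Params) 0 → ℝ) (Zh Z0 : ℝ) (_hZh : 0 ≤ Zh) (_hZ0 : 0 ≤ Z0)
      (_hζs : ∀ x : Site (⟨d + 1, L, m, K, hd, hL⟩ : Params) 0, ζ x ≠ 0 →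
        torusSupNorm (Mk (⟨d + 1, L, m, K, hd, hL⟩ : Params) j) (rep (Mk (⟨d + 1, L, m, K, hd, hL⟩ : Params) j) (iterBlockOf j x) - rep (Mk (⟨d + 1, L, m, K, hd, hL⟩ : Params) j) y) ≤ r)
      (_hζ0 : ∀ x : Site (⟨d + 1, L, m, K, hd, hL⟩ : Params) 0, |ζ x| ≤ Z0)
      (b₁ b₂ : PBond (⟨d + 1, L, m, K, hd, hL⟩ : Params) 0) (_hdir : b₁.dir = b₂.dir) (_hle : supDist b₁.src b₂.src ≤ L ^ j)
      (_hζh : |ζ b₁.src - ζ b₂.src| ≤ Zh * (((supDist b₁.src b₂.src : ℕ) : ℝ) / (L : ℝ) ^ j) ^ α),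
      |ζ b₁.src * (((L : ℝ) ^ j) * ((tsV1 hc Λ' w).G J ⟨b₁.src.shift lam, b₁.dir⟩ - (tsV1 hc Λ' w).G J b₁)) -
        ζ b₂.src * (((L : ℝ) ^ j) * ((tsV1 hc Λ' w).G J ⟨b₂.src.shift lam, b₂.dir⟩ - (tsV1 hc Λ' w).G J b₂))| ≤
        C * Real.exp ((1 + 2 * δ) * (r + 1)) *
          Real.exp (-(δ * torusSupNorm (Mk (⟨d + 1, L, m, K, hd, hL⟩ : Params) j) (rep (Mk (⟨d + 1, L, m, K, hd, hL⟩ : Params) j) y - rep (Mk (⟨d + 1, L, m, K, hd, hL⟩ : Params) j) y'))) * (Zh + Z0) * X * (((supDist b₁.src b₂.src : ℕ) : ℝ) / (L : ℝ) ^ j) ^ α := by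
  obtain ⟨δS, hδS, CS, hCS, hS⟩ := blockBound_DG_scaling d L hd hL ha₀ ha₁
  obtain ⟨δH, hδH, HH⟩ := holderBound_DG_rateFree d L hd hL ha₀ ha₁
  refine ⟨min δS δH, lt_min hδS hδH, fun α hα0 hα1 => ?_⟩
  obtain ⟨CH, hCH, hH⟩ := HH α hα0 hα1
  have hK10 : 0 ≤ latticeConst (d + 1) 1 := latticeConst_nonneg _ zero_le_one
  refine ⟨(CS + CH) * latticeConst (d + 1) 1, by positivity, ?_⟩
  intro m K j hc hj Λ' w hw0 hw1 lam r hr J X hX y y' hsupp hJ ζ Zh Z0 hZh hZ0 hζs hζ0 b₁ b₂ hdir hle hζh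
  have hj' : j ≤ m + K := Nat.le_of_succ_le hj
  have hL0 : 0 < L := by have := hL.2; omega
  have hLp : (0 : ℝ) < L := by exact_mod_cast hL0
  have hLj : (0 : ℝ) < (L : ℝ) ^ j := by positivity
  set δ' : ℝ := min δS δH with hδ'
  have hδ'0 : 0 ≤ δ' := le_min hδS.le hδH.le
  have hδ'S : δ' ≤ δS := min_le_left _ _
  have hδ'H : δ' ≤ δH := min_le_right _ _
  have ht0 : 0 ≤ (((supDist b₁.src b₂.src : ℕ) : ℝ) / (L : ℝ) ^ j) := by positivity
  have htα0 : 0 ≤ (((supDist b₁.src b₂.src : ℕ) : ℝ) / (L : ℝ) ^ j) ^ α := Real.rpow_nonneg ht0 _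
  have hρ : IsPseudoDist (fun t t' : Site (⟨d + 1, L, m, K, hd, hL⟩ : Params) j => torusSupNorm (Mk (⟨d + 1, L, m, K, hd, hL⟩ : Params) j) (rep (Mk (⟨d + 1, L, m, K, hd, hL⟩ : Params) j) t - rep (Mk (⟨d + 1, L, m, K, hd, hL⟩ : Params) j) t')) := torusDist_isPseudoDist (Mk (⟨d + 1, L, m, K, hd, hL⟩ : Params) j)
  have hK : SumBound (fun t t' : Site (⟨d + 1, L, m, K, hd, hL⟩ : Params) j => torusSupNorm (Mk (⟨d + 1, L, m, K, hd, hL⟩ : Params) j) (rep (Mk (⟨d + 1, L, m, K, hd, hL⟩ : Params) j) t - rep (Mk (⟨d + 1, L, m, K, hd, hL⟩ : Params) j) t')) (fun a => latticeConst (d + 1) a) := torusDist_sumBound (Mk (⟨d + 1, L, m, K, hd, hL⟩ : Params) j)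
  -- the trivial case: both values of the cut-off vanish
  by_cases hz : ζ b₁.src = 0 ∧ ζ b₂.src = 0
  · rw [hz.1, hz.2, zero_mul, zero_mul, sub_zero, abs_zero]
    positivity
  -- otherwise the anchor `y(x)` is within `r + 1` of `y` (`|y(x) − y(x′)|_T ≤ 1`)
  have hz1 : torusSupNorm (Mk (⟨d + 1, L, m, K, hd, hL⟩ : Params) j) (rep (Mk (⟨d + 1, L, m, K, hd, hL⟩ : Params) j) (iterBlockOf j b₁.src) - rep (Mk (⟨d + 1, L, m, K, hd, hL⟩ : Params) j) y) ≤ r + 1 := by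
    rw [not_and_or] at hz
    rcases hz with h1 | h2
    · exact (hζs _ h1).trans (by linarith)
    · have h12 : torusSupNorm (Mk (⟨d + 1, L, m, K, hd, hL⟩ : Params) j) (rep (Mk (⟨d + 1, L, m, K, hd, hL⟩ : Params) j) (iterBlockOf j b₁.src) - rep (Mk (⟨d + 1, L, m, K, hd, hL⟩ : Params) j) (iterBlockOf j b₂.src)) ≤ 1 := by
        rw [← supDist_cast_eq_torusSupNorm]
        exact_mod_cast supDist_blk_le_one hj' b₁.src b₂.src hle
      calc torusSupNorm (Mk (⟨d + 1, L, m, K, hd, hL⟩ : Params) j) (rep (Mk (⟨d + 1, L, m, K, hd, hL⟩ : Params) j) (iterBlockOf j b₁.src) - rep (Mk (⟨d + 1, L, m, K, hd, hL⟩ : Params) j) y)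
          ≤ torusSupNorm (Mk (⟨d + 1, L, m, K, hd, hL⟩ : Params) j) (rep (Mk (⟨d + 1, L, m, K, hd, hL⟩ : Params) j) (iterBlockOf j b₁.src) - rep (Mk (⟨d + 1, L, m, K, hd, hL⟩ : Params) j) (iterBlockOf j b₂.src)) +
            torusSupNorm (Mk (⟨d + 1, L, m, K, hd, hL⟩ : Params) j) (rep (Mk (⟨d + 1, L, m, K, hd, hL⟩ : Params) j) (iterBlockOf j b₂.src) - rep (Mk (⟨d + 1, L, m, K, hd, hL⟩ : Params) j) y) := hρ.triangle _ _ _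
        _ ≤ 1 + r := add_le_add h12 (hζs _ h2)
        _ = r + 1 := add_comm _ _
  -- the sup part `|(∇_λGJ)_ν(x)|` at the rate `δ'` (p22 file 10)
  have bS := blockBound_mono hρ (((((L : ℝ) ^ j) • (onE (LinearMap.funLeft ℝ ℝ (fun b : PBond (⟨d + 1, L, m, K, hd, hL⟩ : Params) 0 =>
              (⟨b.src.shift lam, b.dir⟩ : PBond (⟨d + 1, L, m, K, hd, hL⟩ : Params) 0))) - LinearMap.id) :
          BondSpace (⟨d + 1, L, m, K, hd, hL⟩ : Params) →ₗ[ℝ] BondSpace (⟨d + 1, L, m, K, hd, hL⟩ : Params))) ∘ₗ (tsV1 hc Λ' w).G)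
    (fun b₀ : PBond (⟨d + 1, L, m, K, hd, hL⟩ : Params) 0 => iterBlockOf j b₀.src) (fun b₀ : PBond (⟨d + 1, L, m, K, hd, hL⟩ : Params) 0 => iterBlockOf j b₀.src) hCS le_rfl hδ'S (hS m K j hc hj Λ' w hw0 hw1 lam)
  have hSx := abs_apply_le_of_support hρ hK (((((L : ℝ) ^ j) • (onE (LinearMap.funLeft ℝ ℝ (fun b : PBond (⟨d + 1, L, m, K, hd, hL⟩ : Params) 0 =>
              (⟨b.src.shift lam, b.dir⟩ : PBond (⟨d + 1, L, m, K, hd, hL⟩ : Params) 0))) - LinearMap.id) :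
          BondSpace (⟨d + 1, L, m, K, hd, hL⟩ : Params) →ₗ[ℝ] BondSpace (⟨d + 1, L, m, K, hd, hL⟩ : Params))) ∘ₗ (tsV1 hc Λ' w).G)
    (fun b₀ : PBond (⟨d + 1, L, m, K, hd, hL⟩ : Params) 0 => iterBlockOf j b₀.src) (fun b₀ : PBond (⟨d + 1, L, m, K, hd, hL⟩ : Params) 0 => iterBlockOf j b₀.src) hCS hδ'0 hX bS J y y'
    (fun k hk => (hsupp k hk).trans (by linarith)) hJ b₁ hz1
  rw [Dop_comp_apply] at hSx
  -- the pair part `|(∇_λGJ)_ν(x) − (∇_λGJ)_ν(x′)|` at the rate `δ'` (§1)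
  have pH := holderBound_mono hρ (((((L : ℝ) ^ j) • (onE (LinearMap.funLeft ℝ ℝ (fun b : PBond (⟨d + 1, L, m, K, hd, hL⟩ : Params) 0 =>
              (⟨b.src.shift lam, b.dir⟩ : PBond (⟨d + 1, L, m, K, hd, hL⟩ : Params) 0))) - LinearMap.id) :
          BondSpace (⟨d + 1, L, m, K, hd, hL⟩ : Params) →ₗ[ℝ] BondSpace (⟨d + 1, L, m, K, hd, hL⟩ : Params))) ∘ₗ (tsV1 hc Λ' w).G) (fun b₀ : PBond (⟨d + 1, L, m, K, hd, hL⟩ : Params) 0 => iterBlockOf j b₀.src) b₁ b₂ (iterBlockOf j b₁.src)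
    (C' := CH * (((supDist b₁.src b₂.src : ℕ) : ℝ) / (L : ℝ) ^ j) ^ α) (by positivity) le_rfl hδ'H (hH m K j hc hj Λ' w hw0 hw1 lam b₁ b₂ hdir hle)
  have hHx := pairDiff_le_of_support hρ hK (((((L : ℝ) ^ j) • (onE (LinearMap.funLeft ℝ ℝ (fun b : PBond (⟨d + 1, L, m, K, hd, hL⟩ : Params) 0 =>
              (⟨b.src.shift lam, b.dir⟩ : PBond (⟨d + 1, L, m, K, hd, hL⟩ : Params) 0))) - LinearMap.id) :
          BondSpace (⟨d + 1, L, m, K, hd, hL⟩ : Params) →ₗ[ℝ] BondSpace (⟨d + 1, L, m, K, hd, hL⟩ : Params))) ∘ₗ (tsV1 hc Λ' w).G) (fun b₀ : PBond (⟨d + 1, L, m, K, hd, hL⟩ : Params) 0 => iterBlockOf j b₀.src) b₁ b₂ (iterBlockOf j b₁.src)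
    (by positivity) hδ'0 hX pH J y y' (fun k hk => (hsupp k hk).trans (by linarith)) hJ hz1
  rw [Dop_comp_apply, Dop_comp_apply] at hHx
  -- the cut-off product rule
  refine (abs_cutoff_pairDiff_le hSx hHx hζh (hζ0 b₂.src)).trans ?_
  have hE0 : 0 ≤ (((supDist b₁.src b₂.src : ℕ) : ℝ) / (L : ℝ) ^ j) ^ α * (latticeConst (d + 1) 1 * Real.exp ((1 + 2 * δ') * (r + 1)) *
      Real.exp (-(δ' * torusSupNorm (Mk (⟨d + 1, L, m, K, hd, hL⟩ : Params) j) (rep (Mk (⟨d + 1, L, m, K, hd, hL⟩ : Params) j) y - rep (Mk (⟨d + 1, L, m, K, hd, hL⟩ : Params) j) y')))) * X := by positivity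
  have hcoef : Zh * CS + Z0 * CH ≤ (CS + CH) * (Zh + Z0) := by nlinarith [mul_nonneg hCS hZ0, mul_nonneg hCH hZh]
  calc Zh * (((supDist b₁.src b₂.src : ℕ) : ℝ) / (L : ℝ) ^ j) ^ α * (CS * (latticeConst (d + 1) 1 * Real.exp ((1 + 2 * δ') * (r + 1))) *
          Real.exp (-(δ' * torusSupNorm (Mk (⟨d + 1, L, m, K, hd, hL⟩ : Params) j) (rep (Mk (⟨d + 1, L, m, K, hd, hL⟩ : Params) j) y - rep (Mk (⟨d + 1, L, m, K, hd, hL⟩ : Params) j) y'))) * X) +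
        Z0 * (CH * (((supDist b₁.src b₂.src : ℕ) : ℝ) / (L : ℝ) ^ j) ^ α * (latticeConst (d + 1) 1 * Real.exp ((1 + 2 * δ') * (r + 1))) *
          Real.exp (-(δ' * torusSupNorm (Mk (⟨d + 1, L, m, K, hd, hL⟩ : Params) j) (rep (Mk (⟨d + 1, L, m, K, hd, hL⟩ : Params) j) y - rep (Mk (⟨d + 1, L, m, K, hd, hL⟩ : Params) j) y'))) * X)
        = (Zh * CS + Z0 * CH) * ((((supDist b₁.src b₂.src : ℕ) : ℝ) / (L : ℝ) ^ j) ^ α * (latticeConst (d + 1) 1 * Real.exp ((1 + 2 * δ') * (r + 1)) *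
          Real.exp (-(δ' * torusSupNorm (Mk (⟨d + 1, L, m, K, hd, hL⟩ : Params) j) (rep (Mk (⟨d + 1, L, m, K, hd, hL⟩ : Params) j) y - rep (Mk (⟨d + 1, L, m, K, hd, hL⟩ : Params) j) y')))) * X) := by ring
    _ ≤ (CS + CH) * (Zh + Z0) * ((((supDist b₁.src b₂.src : ℕ) : ℝ) / (L : ℝ) ^ j) ^ α * (latticeConst (d + 1) 1 * Real.exp ((1 + 2 * δ') * (r + 1)) *
          Real.exp (-(δ' * torusSupNorm (Mk (⟨d + 1, L, m, K, hd, hL⟩ : Params) j) (rep (Mk (⟨d + 1, L, m, K, hd, hL⟩ : Params) j) y - rep (Mk (⟨d + 1, L, m, K, hd, hL⟩ : Params) j) y')))) * X) :=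
        mul_le_mul_of_nonneg_right hcoef hE0
    _ = _ := by rw [hδ']; ring

end Literature.MathematicalPhysics.QuantumFieldTheory.Balaban1983to89.B6Prop25HolderRateFreeV1
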